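import Literature.NumberTheory.Sieve.Maynard2016Lemma3Proof
import Literature.NumberTheory.Sieve.Maynard2016Lemma4Proof
import Literature.NumberTheory.Sieve.RankinSmoothBound
import Literature.NumberTheory.Multiplicative.SmoothNumbersRankinTail
import HarnessLib

/-!
# Maynard (2016), *Large gaps between primes* — Lemma 2, PROVED

`Maynard2016.Lemma2` (stated in `Maynard2016LargeGapsStatements`): for every `C_U > 0`, all
sufficiently small `ε > 0`, some `K` and all large `x`,
`#𝓡'(x) ≤ K · x/(log x)^{1+ε}`, where `𝓡' = {n ≤ U : n is ⌊y⌋-smooth, (n − 1, P(⌊y⌋)) = 1}`,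
`log y = (1 − ε) log x · log₃ x / log₂ x` and `U = C_U x log y / log₂ x`. This is
Maier–Pomerance [MP90, Theorem 5.3], quoted by Maynard [Maynard2016LargeGaps, Lemma 2]. We PROVE it
(`theorem lemma2_holds : Lemma2`, with `K = 3`, for every `0 < ε ≤ 1/4`) from results already in
the tree; no new named fact is introduced. Together with `Maynard2016Lemma3Proof` this leaves
`GPYMeasures` as the only named input of `Maynard2016.theorem1` (`theorem1_of_lemma2_GPY`).

## Proof (Maier–Pomerance §5, re-cut so that Rankin's method suffices)

Notation: `L = log x`, `L₂ = log L`, `L₃ = log L₂`, `L₄ = log L₃`, `Λ = log y = (1 − ε) L L₃/L₂`,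
`P = ⌊y⌋`, `T = x/L^{1+ε}`, `k₁ = ⌊y^{1/8}⌋ + 1`, `ℓ = log k₁ ≈ Λ/8`, `w = L₃ − 2 L₄`.
Every `n ∈ 𝓡'` is (i) `≤ T`, or (ii) `k₁`-smooth, or (iii) `n = m p` with `p = P⁺(n) ≥ k₁` prime and
`m` even (`n` is even since `(n − 1, 2) = 1`), `(P+1)`-smooth, `T/P ≤ m ≤ ⌊U⌋/k₁`, and then
`(mp − 1, P(z_m)) = 1` for `z_m = min(P, ⌊(⌊U⌋/m)^{1/8}⌋)` (`card_smooth_coprime_le_decomp`).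
Each class has at most `T` elements (`lemma2_core`), whence `K = 3`:
* (ii) `smooth_part_le`: Rankin's bound `Ψ(U, k₁) ≤ U^{1−η₁} ∏_{p<k₁}(1 − p^{−(1−η₁)})⁻¹`
  (`card_smoothNumbersUpTo_le_rankin`) with `η₁ = w/ℓ`, and the Euler product estimate of §1,
  `∏_{p<k}(1 − p^{−(1−η)})⁻¹ ≤ exp(log log k + 12 + η k^η (log k + 2))`
  (`prod_primesBelow_inv_one_sub_rpow_le_exp_loglog`), which loses a single `log k` (the tree's
  `prod_primesBelow_inv_one_sub_rpow_le` loses `(log k)^4`, too much for (iii)). Maier–Pomerance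
  split at `y^{1/2}` and used de Bruijn's asymptotic for `Ψ`; at height `y^{1/8}` Rankin's upper
  bound is enough (`U^{−η₁} ≈ (L₃²/L₂)^{8/(1−ε)}` against the loss `L^{1+ε} · Λ ≈ L₂^{O(1)} …`:
  here `log U − (1+ε) L₂ − 8 L₂ …` is negative with room `L₂`).
* (iii) `sieve_term_le`: for even `m` and `N = ⌊U⌋/m ≥ k₁`,
  `#{p ≤ N : (mp − 1, P(z_m)) = 1} ≤ c_B L₂² (U/m)/ℓ²`, by the dimension-`1` fundamental lemma in
  its uniform form (`SieveSequence.fundamental_lemma_uniform_holds`; the dimension constant of `g₂`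
  serves every even `m`, `hasSieveDimension_shiftedPrimesDensity_of_even`) applied to the sequence
  `lemma3Seq m 0 N` of `Maynard2016Lemma3Proof` (`𝒜 = {mp − 1 : p ≤ N}`), sieving level `N^{1/8}`,
  level of distribution `N^{1/4}` with the remainders summed by Bombieri–Vinogradov in `π`-form
  (`Chen.eventually_sum_abs_primeCountingDisc_le BombieriVinogradovStatement_holds`, saving
  `(log N)^8`), `π(N) ≤ 2N/log N` (`Chen.eventually_primeCounting_bounds`), and the main term
  `V(z_m) ≤ oddPrimeProd(z_m) · 𝔊(m) ≤ (6/log z_m) (m/φ(m))²` (`oddPrimeProd_le`,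
  `oddSingProd_le_sq_div_totient`, `self_div_totient_le`: `m/φ(m) ≤ 3⁹ + 4e⁵ L₂`)
  (`sieve_count_le`). Then `sifted_part_le`: `∑ 1/m` over `(P+1)`-smooth `m ≥ T/P` is Rankin's
  harmonic tail (`SmoothRankin.sum_inv_smooth_tail_le`)
  `≤ (T/P)^{−η} ∏_{p ≤ P}(1 − p^{−(1−η)})⁻¹` with `η = w/Λ`; by §1 the product is
  `≤ exp(log(Λ+1) + 12 + w e^w (1 + 3/Λ))`, `e^w = L₂/L₃²`, and (`key_exponent`)
  `η log T ≥ (1+ε) L₂ + ε² L₂ − 4 L₄L₂/L₃ − 1`: the term `ε² L₂` (from `1/(1−ε) ≥ 1 + ε + ε²`)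
  absorbs `L₂³`, `exp(2 L₂/L₃)`, `log Λ ≤ L₂` against `U/x ≈ Λ/L₂`, and the constants, under the
  growth conditions G1–G12 of `lemma2_core` (`ε² L₃ ≥ 24, 16 L₄`; `ε² L₂ ≥ 8 L₃,
  4 log(128 c_B C_U) + 52`; `L ≥ 6 L₂²`; …), which hold for `x ≥ x₀(ε, C_U)` (`eventually_logs₂`).

## Main statements

* `prod_primesBelow_inv_one_sub_rpow_le_exp_loglog` — the `log k`-sharp Euler product (§1).
* `oddSingProd_le_sq_div_totient`, `self_div_totient_le` — `𝔊(m) ≤ (m/φ(m))² ≪ L₂²`.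
* `sieve_count_le`, `sieve_term_le` — the upper-bound sieve for `{mp − 1}` at one scale.
* `card_smooth_coprime_le_decomp`, `smooth_part_le`, `sifted_part_le`, `lemma2_core` — the
  decomposition and the three bounds at one `x`.
* `lemma2_holds : Lemma2`.

## References

* [Maynard2016LargeGaps] J. Maynard, *Large gaps between primes*, Ann. of Math. 183 (2016),
  Lemma 2 (arXiv:1408.5110, §2).
* [MP90] H. Maier, C. Pomerance, *Unusually large gaps between consecutive primes*,
  Trans. AMS 322 (1990), Theorem 5.3, doi:10.1090/s0002-9947-1990-0972703-x.
* [Tenenbaum2015] G. Tenenbaum, *Introduction to analytic and probabilistic number theory*,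
  III.5 (Rankin's method).
-/

open Finset Filter Real Topology

noncomputable section

namespace Literature.NumberTheory.Sieve

namespace Maynard2016

open SingularProductAverage

/-! ### §1 A sharp Euler product for Rankin's method -/

/-- `t^{-3/2} = 1/(t √t)` for `t > 0`. [folklore] -/
private theorem rpow_neg_three_halves_eq {t : ℝ} (ht : 0 < t) :
    t ^ (-(3 / 2 : ℝ)) = 1 / (t * Real.sqrt t) := by
  rw [Real.rpow_neg ht.le, show (3 / 2 : ℝ) = 1 + 1 / 2 by norm_num, Real.rpow_add ht,
    Real.rpow_one, Real.sqrt_eq_rpow, inv_eq_one_div]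

/-- The telescoping step `1/((K+1)√(K+1)) ≤ 2/√K − 2/√(K+1)` (`K ≥ 1`). [folklore] -/
private theorem telescope_step {K : ℝ} (hK : 1 ≤ K) :
    1 / ((K + 1) * Real.sqrt (K + 1)) ≤ 2 / Real.sqrt K - 2 / Real.sqrt (K + 1) := by
  have ha0 : 0 < Real.sqrt K := Real.sqrt_pos.2 (by linarith)
  have hb0 : 0 < Real.sqrt (K + 1) := Real.sqrt_pos.2 (by linarith)
  have ha2 : Real.sqrt K ^ 2 = K := Real.sq_sqrt (by linarith)
  have hb2 : Real.sqrt (K + 1) ^ 2 = K + 1 := Real.sq_sqrt (by linarith)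
  have hab : Real.sqrt K ≤ Real.sqrt (K + 1) := Real.sqrt_le_sqrt (by linarith)
  set a := Real.sqrt K
  set b := Real.sqrt (K + 1)
  have h1 : (b - a) * (b + a) = 1 := by nlinarith
  have h2 : a * (b + a) ≤ 2 * b ^ 2 := by nlinarith
  have key : a ≤ 2 * b ^ 2 * (b - a) := by
    calc a = a * ((b - a) * (b + a)) := by rw [h1, mul_one]
      _ = (b - a) * (a * (b + a)) := by ring
      _ ≤ (b - a) * (2 * b ^ 2) := mul_le_mul_of_nonneg_left h2 (by linarith)
      _ = 2 * b ^ 2 * (b - a) := by ring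
  rw [← hb2, div_sub_div _ _ ha0.ne' hb0.ne', div_le_div_iff₀ (by positivity) (by positivity)]
  nlinarith [mul_nonneg (sub_nonneg.2 key) hb0.le, ha0, hb0]

/-- `∑_{2 ≤ n ≤ K} n^{-3/2} ≤ 2 − 2/√K`. [folklore] -/
private theorem sum_Icc_rpow_neg_three_halves_le (K : ℕ) :
    ∑ n ∈ Finset.Icc 2 K, (n : ℝ) ^ (-(3 / 2 : ℝ)) ≤ 2 - 2 / Real.sqrt K := by
  induction K with
  | zero => simp
  | succ K ih =>
    rcases Nat.lt_or_ge K 1 with hK | hK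
    · have hK0 : K = 0 := by omega
      subst hK0
      rw [Finset.Icc_eq_empty_of_lt (by norm_num), Finset.sum_empty]
      norm_num
    · rw [Finset.sum_Icc_succ_top (by omega),
        rpow_neg_three_halves_eq (t := ((K + 1 : ℕ) : ℝ)) (by positivity)]
      have hstep := telescope_step (K := (K : ℝ)) (by exact_mod_cast hK)
      push_cast
      linarith

/-- `∑_{p < k} p^{-3/2} ≤ 2`. [folklore] -/
private theorem sum_primesBelow_rpow_neg_three_halves_le (k : ℕ) :
    ∑ p ∈ k.primesBelow, (p : ℝ) ^ (-(3 / 2 : ℝ)) ≤ 2 := by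
  have hsub : k.primesBelow ⊆ Finset.Icc 2 k := by
    intro p hp
    rw [Finset.mem_Icc]
    exact ⟨(Nat.prime_of_mem_primesBelow hp).two_le, (Nat.lt_of_mem_primesBelow hp).le⟩
  calc ∑ p ∈ k.primesBelow, (p : ℝ) ^ (-(3 / 2 : ℝ))
      ≤ ∑ n ∈ Finset.Icc 2 k, (n : ℝ) ^ (-(3 / 2 : ℝ)) :=
        Finset.sum_le_sum_of_subset_of_nonneg hsub fun n _ _ => Real.rpow_nonneg (Nat.cast_nonneg n) _
    _ ≤ 2 - 2 / Real.sqrt k := sum_Icc_rpow_neg_three_halves_le k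
    _ ≤ 2 := by linarith [div_nonneg zero_le_two (Real.sqrt_nonneg (k : ℝ))]

/-- **A sharp Euler product for Rankin's method**: for `k ≥ 2` and `0 < η ≤ 1/4`,
`∏_{p<k} (1 − p^{−(1−η)})⁻¹ ≤ exp(log log k + 12 + η k^η (log k + 2))`, i.e. `≤ e^{12} log k · e^{η k^η(log k+2)}`
— of the true order `log k` (each factor is `≤ exp(t + 4t²)`, `t = p^{−(1−η)} ≤ 1/p + η k^η log p/p`,
`∑ 4t² ≤ 4 ∑ p^{−3/2} ≤ 8`, and Mertens). [cite: Tenenbaum2015, Ch. III.5 §5.1] -/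
theorem prod_primesBelow_inv_one_sub_rpow_le_exp_loglog (k : ℕ) (hk : 2 ≤ k) {η : ℝ} (hη0 : 0 < η)
    (hη : η ≤ 1 / 4) :
    ∏ p ∈ k.primesBelow, (1 - (p : ℝ) ^ (-(1 - η)))⁻¹ ≤
      Real.exp (Real.log (Real.log k) + 12 + η * (k : ℝ) ^ η * (Real.log k + 2)) := by
  have hmem : ∀ p ∈ k.primesBelow, p.Prime ∧ p < k := fun p hp =>
    ⟨Nat.prime_of_mem_primesBelow hp, Nat.lt_of_mem_primesBelow hp⟩
  -- each factor `(1 - t)⁻¹ ≤ exp (t + 4 p^{-3/2})`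
  have hfac : ∀ p ∈ k.primesBelow, (1 - (p : ℝ) ^ (-(1 - η)))⁻¹ ≤
      Real.exp ((p : ℝ) ^ (-(1 - η)) + 4 * (p : ℝ) ^ (-(3 / 2 : ℝ))) := by
    intro p hp
    have hp2 : (2 : ℝ) ≤ p := by exact_mod_cast (hmem p hp).1.two_le
    have hp0 : (0 : ℝ) < p := by linarith
    set t := (p : ℝ) ^ (-(1 - η)) with ht
    have ht0 : 0 ≤ t := Real.rpow_nonneg hp0.le _
    have ht34 : t ≤ 3 / 4 := by
      have h1 : t ≤ (p : ℝ) ^ (-(1 / 2 : ℝ)) :=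
        Real.rpow_le_rpow_of_exponent_le (by linarith) (by linarith)
      have h2 : (p : ℝ) ^ (-(1 / 2 : ℝ)) ≤ (2 : ℝ) ^ (-(1 / 2 : ℝ)) :=
        Real.rpow_le_rpow_of_nonpos (by norm_num) hp2 (by norm_num)
      have h3 : (2 : ℝ) ^ (-(1 / 2 : ℝ)) ≤ 3 / 4 := by
        rw [Real.rpow_neg (by norm_num), ← Real.sqrt_eq_rpow,
          inv_le_comm₀ (Real.sqrt_pos.2 (by norm_num)) (by norm_num),
          Real.le_sqrt (by norm_num) (by norm_num)]
        norm_num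
      linarith
    have ht2 : t ^ 2 ≤ (p : ℝ) ^ (-(3 / 2 : ℝ)) := by
      rw [ht, ← Real.rpow_natCast, ← Real.rpow_mul hp0.le]
      exact Real.rpow_le_rpow_of_exponent_le (by linarith) (by push_cast; linarith)
    have h1t : 0 < 1 - t := by linarith
    have hlog : Real.log (1 - t)⁻¹ ≤ (1 - t)⁻¹ - 1 := by
      rw [Real.log_inv]
      have := Real.one_sub_inv_le_log_of_pos h1t
      linarith
    have hq : (1 - t)⁻¹ - 1 ≤ t + 4 * t ^ 2 := by
      rw [inv_eq_one_div, div_sub_one h1t.ne', div_le_iff₀ h1t]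
      nlinarith [mul_nonneg (sq_nonneg t) (by linarith : (0 : ℝ) ≤ 3 - 4 * t)]
    calc (1 - t)⁻¹ = Real.exp (Real.log (1 - t)⁻¹) := (Real.exp_log (inv_pos.2 h1t)).symm
      _ ≤ Real.exp (t + 4 * (p : ℝ) ^ (-(3 / 2 : ℝ))) := Real.exp_le_exp.2 (by linarith)
  -- the linear terms: `t ≤ 1/p + η k^η log p/p`, summed with Mertens
  have hlin : ∀ p ∈ k.primesBelow, (p : ℝ) ^ (-(1 - η)) ≤
      1 / p + η * (k : ℝ) ^ η * (Real.log p / p) := fun p hp =>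
    rpow_neg_one_sub_le (by exact_mod_cast (hmem p hp).1.two_le)
      (by exact_mod_cast (hmem p hp).2.le) hη0.le
  obtain ⟨hM1, hM2⟩ := sum_primesBelow_inv_le_and k hk
  have hkη : 0 ≤ η * (k : ℝ) ^ η := mul_nonneg hη0.le (Real.rpow_nonneg (Nat.cast_nonneg k) _)
  calc ∏ p ∈ k.primesBelow, (1 - (p : ℝ) ^ (-(1 - η)))⁻¹
      ≤ ∏ p ∈ k.primesBelow, Real.exp ((p : ℝ) ^ (-(1 - η)) + 4 * (p : ℝ) ^ (-(3 / 2 : ℝ))) := by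
        refine Finset.prod_le_prod (fun p hp => ?_) hfac
        have hp2 : (2 : ℝ) ≤ p := by exact_mod_cast (hmem p hp).1.two_le
        have : (p : ℝ) ^ (-(1 - η)) ≤ 3 / 4 := by
          have h1 : (p : ℝ) ^ (-(1 - η)) ≤ (p : ℝ) ^ (-(1 / 2 : ℝ)) :=
            Real.rpow_le_rpow_of_exponent_le (by linarith) (by linarith)
          have h2 : (p : ℝ) ^ (-(1 / 2 : ℝ)) ≤ (2 : ℝ) ^ (-(1 / 2 : ℝ)) :=
            Real.rpow_le_rpow_of_nonpos (by norm_num) hp2 (by norm_num)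
          have h3 : (2 : ℝ) ^ (-(1 / 2 : ℝ)) ≤ 3 / 4 := by
            rw [Real.rpow_neg (by norm_num), ← Real.sqrt_eq_rpow,
              inv_le_comm₀ (Real.sqrt_pos.2 (by norm_num)) (by norm_num),
              Real.le_sqrt (by norm_num) (by norm_num)]
            norm_num
          linarith
        exact inv_nonneg.2 (by linarith)
    _ = Real.exp (∑ p ∈ k.primesBelow, ((p : ℝ) ^ (-(1 - η)) + 4 * (p : ℝ) ^ (-(3 / 2 : ℝ)))) :=
        (Real.exp_sum _ _).symm
    _ ≤ Real.exp (Real.log (Real.log k) + 12 + η * (k : ℝ) ^ η * (Real.log k + 2)) := by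
        apply Real.exp_le_exp.2
        rw [Finset.sum_add_distrib, ← Finset.mul_sum]
        have hS1 : ∑ p ∈ k.primesBelow, (p : ℝ) ^ (-(1 - η)) ≤
            ∑ p ∈ k.primesBelow, (1 / p + η * (k : ℝ) ^ η * (Real.log p / p)) :=
          Finset.sum_le_sum hlin
        rw [Finset.sum_add_distrib, ← Finset.mul_sum] at hS1
        have hS2 := sum_primesBelow_rpow_neg_three_halves_le k
        have hS3 : η * (k : ℝ) ^ η * ∑ p ∈ k.primesBelow, Real.log p / p ≤
            η * (k : ℝ) ^ η * (Real.log k + 2) := mul_le_mul_of_nonneg_left hM2 hkη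
        linarith

/-! ### §2 The singular-series factor -/

/-- For even `m ≥ 1` and every `Y`:
`∏_{p ≤ Y prime, p ∤ m} (p − 2)/(p − 1) ≤ P_Y · ∏_{p ∣ m, p > 2} (p − 1)/(p − 2)` (the factors of `P_Y`
at the odd primes `p ∣ m`, `p ≤ Y` are divided out; the primes `p ∣ m`, `p > Y` only enlarge the right
side). [cite: Maynard2016LargeGaps, §2, Lemma 3 (second display)] -/
theorem prod_coprime_le_oddPrimeProd_mul_oddSingProd {m : ℕ} (hm1 : 1 ≤ m) (hm : Even m) (Y : ℕ) :
    ∏ p ∈ (Finset.Iic Y).filter (fun p => p.Prime ∧ ¬ p ∣ m), (((p : ℝ) - 2) / ((p : ℝ) - 1)) ≤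
      oddPrimeProd Y * oddSingProd m := by
  classical
  set O : Finset ℕ := (Finset.Iic Y).filter (fun p => p.Prime ∧ 2 < p) with hO
  have hsing : ∏ p ∈ (Finset.Iic Y).filter (fun p => p.Prime ∧ ¬ p ∣ m), (((p : ℝ) - 2) / ((p : ℝ) - 1)) =
      ∏ p ∈ O.filter (fun p => ¬ p ∣ m), (((p : ℝ) - 2) / ((p : ℝ) - 1)) := by
    refine prod_congr ?_ fun _ _ => rfl
    ext p
    simp only [hO, mem_filter, mem_Iic]
    constructor
    · rintro ⟨hpY, hp, hpm⟩
      refine ⟨⟨hpY, hp, lt_of_le_of_ne hp.two_le ?_⟩, hpm⟩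
      rintro rfl; exact hpm (even_iff_two_dvd.1 hm)
    · rintro ⟨⟨hpY, hp, -⟩, hpm⟩; exact ⟨hpY, hp, hpm⟩
  have hsplit : (∏ p ∈ O.filter (fun p => p ∣ m), (((p : ℝ) - 2) / ((p : ℝ) - 1))) *
      ∏ p ∈ O.filter (fun p => ¬ p ∣ m), (((p : ℝ) - 2) / ((p : ℝ) - 1)) = oddPrimeProd Y := by
    rw [oddPrimeProd, ← hO]; exact prod_filter_mul_prod_filter_not O (fun p => p ∣ m) _
  have hfac : ∀ p ∈ O, (0 : ℝ) < ((p : ℝ) - 2) / ((p : ℝ) - 1) := by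
    intro p hp
    have h3 : (3 : ℝ) ≤ p := by exact_mod_cast (mem_filter.1 hp).2.2
    exact div_pos (by linarith) (by linarith)
  have hD0 : 0 < ∏ p ∈ O.filter (fun p => p ∣ m), (((p : ℝ) - 2) / ((p : ℝ) - 1)) :=
    prod_pos fun p hp => hfac p (mem_filter.1 hp).1
  have hDinv : (∏ p ∈ O.filter (fun p => p ∣ m), (((p : ℝ) - 2) / ((p : ℝ) - 1)))⁻¹ ≤
      oddSingProd m := by
    rw [← prod_inv_distrib]
    have hsub : O.filter (fun p => p ∣ m) ⊆ m.primeFactors.filter (fun p => 2 < p) := by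
      intro p hp
      rw [mem_filter] at hp ⊢
      have hp' := mem_filter.1 hp.1
      exact ⟨Nat.mem_primeFactors.2 ⟨hp'.2.1, hp.2, by omega⟩, hp'.2.2⟩
    have hge1 : ∀ p ∈ m.primeFactors.filter (fun p => 2 < p),
        (1 : ℝ) ≤ ((p : ℝ) - 1) / ((p : ℝ) - 2) := by
      intro p hp
      have h3 : (3 : ℝ) ≤ p := by exact_mod_cast (mem_filter.1 hp).2
      rw [le_div_iff₀ (by linarith)]; linarith
    have hrest : (1 : ℝ) ≤ ∏ p ∈ m.primeFactors.filter (fun p => 2 < p) \ O.filter (fun p => p ∣ m),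
        (((p : ℝ) - 1) / ((p : ℝ) - 2)) := by
      have h := prod_le_prod (s := m.primeFactors.filter (fun p => 2 < p) \ O.filter (fun p => p ∣ m))
        (fun _ _ => zero_le_one) fun p hp => hge1 p (mem_sdiff.1 hp).1
      simpa using h
    have hS0 : (0 : ℝ) ≤ ∏ p ∈ O.filter (fun p => p ∣ m), (((p : ℝ) - 1) / ((p : ℝ) - 2)) :=
      prod_nonneg fun p hp => le_trans zero_le_one (hge1 p (hsub hp))
    calc ∏ p ∈ O.filter (fun p => p ∣ m), ((((p : ℝ) - 2) / ((p : ℝ) - 1)))⁻¹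
        = ∏ p ∈ O.filter (fun p => p ∣ m), (((p : ℝ) - 1) / ((p : ℝ) - 2)) :=
          prod_congr rfl fun p _ => by rw [inv_div]
      _ ≤ (∏ p ∈ m.primeFactors.filter (fun p => 2 < p) \ O.filter (fun p => p ∣ m),
            (((p : ℝ) - 1) / ((p : ℝ) - 2))) *
          ∏ p ∈ O.filter (fun p => p ∣ m), (((p : ℝ) - 1) / ((p : ℝ) - 2)) :=
          le_mul_of_one_le_left hS0 hrest
      _ = oddSingProd m := by rw [oddSingProd, prod_sdiff hsub]
  have heq : ∏ p ∈ (Finset.Iic Y).filter (fun p => p.Prime ∧ ¬ p ∣ m), (((p : ℝ) - 2) / ((p : ℝ) - 1)) =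
      oddPrimeProd Y * (∏ p ∈ O.filter (fun p => p ∣ m), (((p : ℝ) - 2) / ((p : ℝ) - 1)))⁻¹ := by
    rw [hsing, ← hsplit]
    field_simp
  rw [heq]
  exact mul_le_mul_of_nonneg_left hDinv (oddPrimeProd_pos _).le

/-- **`𝔊(m) ≤ (m/φ(m))²`**: factorwise `(p − 1)/(p − 2) ≤ (p/(p − 1))²` for `p ≥ 3`
(`(p−1)³ ≤ p²(p−2)`), and `m/φ(m) = ∏_{p ∣ m} p/(p − 1)`. [cite: Maynard2016LargeGaps, §2, Lemma 3 (second display)] -/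
theorem oddSingProd_le_sq_div_totient {m : ℕ} (hm : 1 ≤ m) :
    oddSingProd m ≤ ((m : ℝ) / (Nat.totient m : ℝ)) ^ 2 := by
  have hm0 : (0 : ℝ) < m := by exact_mod_cast hm
  have hφ0 : (0 : ℝ) < (Nat.totient m : ℝ) := by exact_mod_cast Nat.totient_pos.2 hm
  have hfac0 : ∀ p ∈ m.primeFactors, (0 : ℝ) < 1 - 1 / (p : ℝ) := by
    intro p hp
    have h2 : (2 : ℝ) ≤ p := by exact_mod_cast (Nat.prime_of_mem_primeFactors hp).two_le
    rw [sub_pos, div_lt_one (by linarith)]; linarith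
  -- `m/φ(m) = ∏ (1 - 1/p)⁻¹`
  have hratio : (m : ℝ) / (Nat.totient m : ℝ) = ∏ p ∈ m.primeFactors, (1 - 1 / (p : ℝ))⁻¹ := by
    rw [Literature.NumberTheory.LFunctions.MertensBound.totient_eq_mul_prod_one_sub_inv m,
      prod_inv_distrib, div_mul_eq_div_div, div_self hm0.ne', one_div]
  rw [hratio, ← prod_pow, oddSingProd]
  calc ∏ p ∈ m.primeFactors.filter (fun p => 2 < p), (((p : ℝ) - 1) / ((p : ℝ) - 2))
      ≤ ∏ p ∈ m.primeFactors.filter (fun p => 2 < p), ((1 - 1 / (p : ℝ))⁻¹) ^ 2 := by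
        refine prod_le_prod (fun p hp => ?_) (fun p hp => ?_)
        · have h3 : (3 : ℝ) ≤ p := by exact_mod_cast (mem_filter.1 hp).2
          exact div_nonneg (by linarith) (by linarith)
        · have h3 : (3 : ℝ) ≤ p := by exact_mod_cast (mem_filter.1 hp).2
          have hp0 : (0 : ℝ) < p := by linarith
          have h1 : (1 - 1 / (p : ℝ))⁻¹ = p / (p - 1) := by
            field_simp
          rw [h1, div_pow, div_le_div_iff₀ (by linarith) (pow_pos (by linarith) 2)]
          nlinarith
    _ ≤ ∏ p ∈ m.primeFactors, ((1 - 1 / (p : ℝ))⁻¹) ^ 2 := by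
        rw [← prod_filter_mul_prod_filter_not m.primeFactors (fun p => 2 < p)]
        refine le_mul_of_one_le_right (prod_nonneg fun p _ => sq_nonneg _) ?_
        have h : ∏ p ∈ m.primeFactors.filter (fun p => ¬ 2 < p), (1 : ℝ) ≤
            ∏ p ∈ m.primeFactors.filter (fun p => ¬ 2 < p), ((1 - 1 / (p : ℝ))⁻¹) ^ 2 :=
          Finset.prod_le_prod (fun _ _ => zero_le_one) (fun p hp => by
            have h0 := hfac0 p (mem_filter.1 hp).1
            have h1 : 1 ≤ (1 - 1 / (p : ℝ))⁻¹ := by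
              rw [one_le_inv₀ h0]
              have : (0 : ℝ) ≤ 1 / p := by positivity
              linarith
            nlinarith)
        simpa using h

/-- `m/φ(m) ≤ 3^9 + 2e^5 log log m₀` for `1 ≤ m ≤ m₀` (`m₀ ≥ 3^9`), from the tree's explicit
`φ(n)/n ≥ e^{−5}/(2 log log n)` (`n ≥ 3^9`). [cite: HardyWright2008, Thm 328 (§18.4)] -/
theorem self_div_totient_le {m m₀ : ℕ} (hm : 1 ≤ m) (hmm₀ : m ≤ m₀) (hm₀ : 3 ^ 9 ≤ m₀) :
    (m : ℝ) / (Nat.totient m : ℝ) ≤ 3 ^ 9 + 2 * Real.exp 5 * Real.log (Real.log m₀) := by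
  have hφ0 : (0 : ℝ) < (Nat.totient m : ℝ) := by exact_mod_cast Nat.totient_pos.2 hm
  have hm₀' : (3 : ℝ) ^ 9 ≤ m₀ := by exact_mod_cast hm₀
  have hll₀ : 0 ≤ Real.log (Real.log m₀) := by
    apply Real.log_nonneg
    rw [Real.le_log_iff_exp_le (by linarith)]
    have : Real.exp 1 ≤ 3 := le_of_lt (lt_trans Real.exp_one_lt_d9 (by norm_num))
    nlinarith
  rcases Nat.lt_or_ge m (3 ^ 9) with h | h
  · -- `m/φ(m) ≤ m < 3^9`
    have h1 : (m : ℝ) / (Nat.totient m : ℝ) ≤ m := by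
      rw [div_le_iff₀ hφ0]
      have : (1 : ℝ) ≤ (Nat.totient m : ℝ) := by exact_mod_cast Nat.totient_pos.2 hm
      nlinarith [(Nat.cast_nonneg m : (0 : ℝ) ≤ m)]
    have h2 : (m : ℝ) ≤ 3 ^ 9 := by exact_mod_cast h.le
    nlinarith [Real.exp_pos 5]
  · have hm0 : (0 : ℝ) < m := by exact_mod_cast hm
    have key := Literature.NumberTheory.LFunctions.MertensBound.totient_div_self_ge m h
    -- `e^{-5}/(2 log log m) ≤ φ/m` ⇒ `m/φ ≤ 2 e^5 log log m`
    have hm3 : (3 : ℝ) ^ 9 ≤ m := by exact_mod_cast h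
    have hllm : 0 < Real.log (Real.log m) := by
      apply Real.log_pos
      rw [Real.lt_log_iff_exp_lt (by linarith)]
      have : Real.exp 1 ≤ 3 := le_of_lt (lt_trans Real.exp_one_lt_d9 (by norm_num))
      nlinarith
    have h1 : (m : ℝ) / (Nat.totient m : ℝ) ≤ 2 * Real.exp 5 * Real.log (Real.log m) := by
      rw [div_le_iff₀ hφ0]
      rw [div_le_div_iff₀ (by positivity) hm0] at key
      have hE : Real.exp (-5) * Real.exp 5 = 1 := by rw [← Real.exp_add]; norm_num
      nlinarith [Real.exp_pos 5, Real.exp_pos (-5)]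
    have h2 : Real.log (Real.log m) ≤ Real.log (Real.log m₀) := by
      apply Real.log_le_log (by
        apply Real.log_pos; linarith)
      exact Real.log_le_log hm0 (by exact_mod_cast hmm₀)
    nlinarith [Real.exp_pos 5]

/-! ### §3 The sieve bound at one scale: `#{p ≤ N : (mp − 1, P(z)) = 1}` for even `m` -/

/-- The primes of `(0, N]` are the primes below `N + 1`. [folklore] -/
private theorem primes_Ioc_zero_eq (N : ℕ) : (Finset.Ioc 0 N).filter Nat.Prime = (N + 1).primesBelow := by
  ext p
  simp only [Finset.mem_filter, Finset.mem_Ioc, Nat.primesBelow, Finset.mem_range, Nat.lt_succ_iff]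
  exact ⟨fun h => ⟨h.1.2, h.2⟩, fun h => ⟨⟨h.2.pos, h.1⟩, h.2⟩⟩

/-- `#{p ≤ N prime} = π(N)`. [folklore] -/
private theorem card_primes_Ioc_zero (N : ℕ) :
    ((Finset.Ioc 0 N).filter Nat.Prime).card = Nat.primeCounting N := by
  rw [primes_Ioc_zero_eq, Nat.primesBelow_card_eq_primeCounting']
  rfl

/-- **The sieve bound at one scale.** For even `m ≥ 1`, `Y_s ≥ e^{12}` with `Y_s + 1 ≤ N^{1/4}`:
`#{p ≤ N : (mp − 1, P_{Y_s}) = 1} ≤ (2N/log N)(6/log Y_s) 𝔊(m) (1 + C_FL) + C_BV N/log⁸ N`, from the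
(upper-bound half of the) fundamental lemma at dimension `1` for `𝒜 = {mp − 1 : p ≤ N}`, sifting
level `P(Y_s + 1)`, `D = N^{1/4}`; Bombieri–Vinogradov for the remainders; `π(N) ≤ 2N/log N`;
`V ≤ P_{Y_s} 𝔊(m)` and Mertens `P_{Y_s} ≤ 6/log Y_s`. [cite: Maynard2016LargeGaps, §2, Lemma 2 (proof, via
Maier–Pomerance); HalberstamRichert1974, Thm 2.2] -/
theorem sieve_count_le {C_FL K₁ C_BV : ℝ} (hCFL : 0 ≤ C_FL)
    (hFL : ∀ A : SieveSequence, HasSieveDimension A.density 1 K₁ →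
      ∀ x z D : ℝ, 2 ≤ z → z ≤ D → 0 ≤ A.size x →
        |A.sifted x (primesProdBelow z) - A.size x * A.densityProduct (primesProdBelow z)| ≤
          C_FL * A.size x * A.densityProduct (primesProdBelow z) *
              Real.exp (-(Real.log D / Real.log z)) +
            ∑ d ∈ (primesProdBelow z).divisors.filter (fun d : ℕ => (d : ℝ) ≤ D), |A.remainder d x|)
    (hK₁ : HasSieveDimension (shiftedPrimesDensity 2) 1 K₁) {N : ℕ}
    (hBV : ∀ a : (q : ℕ) → (ZMod q)ˣ,
      ∑ q ∈ Finset.Icc 1 ⌊(N : ℝ) ^ ((1 : ℝ) / 4)⌋₊, |primeCountingDisc q (a q : ZMod q) N| ≤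
        C_BV * N / Real.log N ^ 8)
    (hπ : (Nat.primeCounting N : ℝ) ≤ 2 * N / Real.log N) (hN : 1 < N)
    {m : ℕ} (hm1 : 1 ≤ m) (hm : Even m) {Ys : ℕ} (hYs : Real.exp 12 ≤ (Ys : ℝ))
    (hYsD : ((Ys + 1 : ℕ) : ℝ) ≤ (N : ℝ) ^ ((1 : ℝ) / 4)) :
    ((((Finset.Ioc 0 N).filter Nat.Prime).filter
        (fun p => Nat.Coprime (m * p - 1) (primorial Ys))).card : ℝ) ≤
      2 * N / Real.log N * (6 / Real.log Ys) * oddSingProd m * (1 + C_FL) +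
        C_BV * N / Real.log N ^ 8 := by
  have hdim : HasSieveDimension (lemma3Seq m 0 N).density 1 K₁ :=
    hasSieveDimension_shiftedPrimesDensity_of_even hK₁ hm
  have hYs1 : (1 : ℝ) ≤ Ys := le_trans (by have := Real.add_one_le_exp (12 : ℝ); linarith) hYs
  have h2zs : (2 : ℝ) ≤ ((Ys + 1 : ℕ) : ℝ) := by push_cast; linarith
  have hsize : (0 : ℝ) ≤ (lemma3Seq m 0 N).size ((m * N : ℕ) : ℝ) := Nat.cast_nonneg _
  have hFLA := hFL (lemma3Seq m 0 N) hdim ((m * N : ℕ) : ℝ) ((Ys + 1 : ℕ) : ℝ)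
    ((N : ℝ) ^ ((1 : ℝ) / 4)) h2zs hYsD hsize
  rw [primesProdBelow_natCast_add_one, sifted_lemma3Seq_eq hm1, densityProduct_lemma3Seq_primorial]
    at hFLA
  set W := ∏ p ∈ (Finset.Iic Ys).filter (fun p => p.Prime ∧ ¬ p ∣ m), (((p : ℝ) - 2) / ((p : ℝ) - 1))
    with hW
  set S := ((((Finset.Ioc 0 N).filter Nat.Prime).filter
        (fun p => Nat.Coprime (m * p - 1) (primorial Ys))).card : ℝ) with hS
  have hXeq : (lemma3Seq m 0 N).size ((m * N : ℕ) : ℝ) = (Nat.primeCounting N : ℝ) := by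
    change ((((Finset.Ioc 0 N).filter Nat.Prime).card : ℕ) : ℝ) = _
    rw [card_primes_Ioc_zero]
  rw [hXeq] at hFLA
  -- the remainder sum: Bombieri–Vinogradov (the terms at height `0` vanish)
  have hR := remainderSum_lemma3Seq_le hm1 (Nat.zero_le N) (primorial Ys) ((N : ℝ) ^ ((1 : ℝ) / 4))
  simp only [primeCountingDisc_zero, abs_zero, Finset.sum_const_zero, add_zero] at hR
  have hRBV := hR.trans (hBV (lemma3Residue m))
  -- sizes
  have hW0 : 0 ≤ W := prod_nonneg fun p hp => by
    have h2 : (2 : ℝ) ≤ p := by exact_mod_cast (mem_filter.1 hp).2.1.two_le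
    exact div_nonneg (by linarith) (by linarith)
  have hWle : W ≤ 6 / Real.log Ys * oddSingProd m := by
    refine (prod_coprime_le_oddPrimeProd_mul_oddSingProd hm1 hm Ys).trans ?_
    exact mul_le_mul_of_nonneg_right (oddPrimeProd_le hYs) (oddSingProd_nonneg m)
  have hπ0 : (0 : ℝ) ≤ (Nat.primeCounting N : ℝ) := Nat.cast_nonneg _
  have hN1 : (1 : ℝ) < N := by exact_mod_cast hN
  have hlogN : 0 < Real.log N := Real.log_pos hN1
  have hexp1 : Real.exp (-(Real.log ((N : ℝ) ^ ((1 : ℝ) / 4)) / Real.log ((Ys + 1 : ℕ) : ℝ))) ≤ 1 := by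
    rw [Real.exp_le_one_iff, neg_nonpos]
    refine div_nonneg (Real.log_nonneg ?_) (Real.log_nonneg (by linarith))
    exact Real.one_le_rpow hN1.le (by norm_num)
  have habs := (abs_sub_le_iff.1 hFLA).1
  -- `S ≤ πW + C_FL π W e^{-s} + R ≤ π W (1 + C_FL) + R`
  have h1 : S ≤ (Nat.primeCounting N : ℝ) * W * (1 + C_FL) + C_BV * N / Real.log N ^ 8 := by
    have hPW : 0 ≤ (Nat.primeCounting N : ℝ) * W := mul_nonneg hπ0 hW0
    have : C_FL * (Nat.primeCounting N : ℝ) * W *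
        Real.exp (-(Real.log ((N : ℝ) ^ ((1 : ℝ) / 4)) / Real.log ((Ys + 1 : ℕ) : ℝ))) ≤
          C_FL * (Nat.primeCounting N : ℝ) * W := by
      have h0 : 0 ≤ C_FL * (Nat.primeCounting N : ℝ) * W := by positivity
      exact (mul_le_mul_of_nonneg_left hexp1 h0).trans_eq (mul_one _)
    nlinarith
  -- `π W ≤ (2N/log N)(6/log Ys) 𝔊(m)`
  have h2 : (Nat.primeCounting N : ℝ) * W ≤ 2 * N / Real.log N * (6 / Real.log Ys * oddSingProd m) :=
    mul_le_mul hπ hWle hW0 (by positivity)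
  have h3 : (Nat.primeCounting N : ℝ) * W * (1 + C_FL) ≤
      2 * N / Real.log N * (6 / Real.log Ys) * oddSingProd m * (1 + C_FL) := by
    have := mul_le_mul_of_nonneg_right h2 (by linarith : (0 : ℝ) ≤ 1 + C_FL)
    linarith [this]
  linarith

/-! ### §4 Decomposition of `𝓡'` by the largest prime factor -/

/-- **The Maier–Pomerance decomposition.** Every `n ≤ U_f`, `n` `P`-smooth with `(n − 1, P#) = 1`
(so `n` is even) is either `≤ T`, or `k₁`-smooth (largest prime factor `< k₁`), or `n = mp` with
`p = P⁺(n) ≥ k₁` an odd prime, `m = n/p` even, `P`-smooth, `T/P ≤ m ≤ U_f/k₁`, and then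
`p ≤ U_f/m` with `(mp − 1, P(Y_s(m))#) = 1` for any `Y_s(m) ≤ P`. Hence
`#𝓡 ≤ T + Ψ(U_f, k₁) + ∑_m #{p ≤ U_f/m : (mp − 1, Y_s(m)#) = 1}`.
[cite: Maynard2016LargeGaps, §2, Lemma 2; MaierPomerance1990, Thm 5.3 (proof)] -/
theorem card_smooth_coprime_le_decomp (Uf P : ℕ) (hP : 2 ≤ P) {T : ℝ} (hT : 0 ≤ T) {k₁ : ℕ}
    (hk₁ : 3 ≤ k₁) (Ys : ℕ → ℕ) (hYs : ∀ m, Ys m ≤ P) :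
    ((((Finset.Icc 1 Uf).filter (fun n => (∀ p ∈ n.primeFactors, p ≤ P) ∧
        Nat.Coprime (n - 1) (primorial P))).card : ℕ) : ℝ) ≤
      T + ((Nat.smoothNumbersUpTo Uf k₁).card : ℝ) +
        ∑ m ∈ (((Finset.Icc 1 (Uf / k₁)).filter (· ∈ Nat.smoothNumbers (P + 1))).filter
            (fun m : ℕ => T / P ≤ (m : ℝ))).filter (fun m => Even m),
          (((((Finset.Ioc 0 (Uf / m)).filter Nat.Prime).filter
            (fun p => Nat.Coprime (m * p - 1) (primorial (Ys m)))).card : ℕ) : ℝ) := by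
  classical
  set R := (Finset.Icc 1 Uf).filter (fun n => (∀ p ∈ n.primeFactors, p ≤ P) ∧
        Nat.Coprime (n - 1) (primorial P)) with hR
  set M := (((Finset.Icc 1 (Uf / k₁)).filter (· ∈ Nat.smoothNumbers (P + 1))).filter
            (fun m : ℕ => T / P ≤ (m : ℝ))).filter (fun m => Even m) with hM
  set Q : ℕ → Finset ℕ := fun m => ((Finset.Ioc 0 (Uf / m)).filter Nat.Prime).filter
            (fun p => Nat.Coprime (m * p - 1) (primorial (Ys m))) with hQ
  change ((R.card : ℕ) : ℝ) ≤ T + ((Nat.smoothNumbersUpTo Uf k₁).card : ℝ) + ∑ m ∈ M, (((Q m).card : ℕ) : ℝ)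
  -- three pieces
  set R₀ := R.filter (fun n : ℕ => (n : ℝ) ≤ T) with hR₀
  set R₁ := R.filter (fun n => ∀ p ∈ n.primeFactors, p < k₁) with hR₁
  set R₂ := R.filter (fun n : ℕ => T < (n : ℝ) ∧ ∃ p ∈ n.primeFactors, k₁ ≤ p) with hR₂
  have hcover : R ⊆ R₀ ∪ (R₁ ∪ R₂) := by
    intro n hn
    by_cases h0 : (n : ℝ) ≤ T
    · exact Finset.mem_union.2 (Or.inl (Finset.mem_filter.2 ⟨hn, h0⟩))
    · by_cases h1 : ∀ p ∈ n.primeFactors, p < k₁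
      · exact Finset.mem_union.2 (Or.inr (Finset.mem_union.2 (Or.inl (Finset.mem_filter.2 ⟨hn, h1⟩))))
      · push Not at h0 h1
        obtain ⟨p, hp, hpk⟩ := h1
        exact Finset.mem_union.2 (Or.inr (Finset.mem_union.2 (Or.inr
          (Finset.mem_filter.2 ⟨hn, h0, p, hp, hpk⟩))))
  -- `R₀ ⊆ [1, ⌊T⌋]`
  have h0 : (R₀.card : ℝ) ≤ T := by
    have hsub : R₀ ⊆ Finset.Icc 1 ⌊T⌋₊ := by
      intro n hn
      simp only [hR₀, hR, Finset.mem_filter, Finset.mem_Icc] at hn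
      rw [Finset.mem_Icc]
      exact ⟨hn.1.1.1, Nat.le_floor hn.2⟩
    calc (R₀.card : ℝ) ≤ ((Finset.Icc 1 ⌊T⌋₊).card : ℝ) := by exact_mod_cast Finset.card_le_card hsub
      _ = ⌊T⌋₊ := by rw [Nat.card_Icc, Nat.add_sub_cancel]
      _ ≤ T := Nat.floor_le hT
  -- `R₁ ⊆ Ψ(U_f, k₁)`
  have h1 : R₁.card ≤ (Nat.smoothNumbersUpTo Uf k₁).card := by
    refine Finset.card_le_card fun n hn => ?_
    simp only [hR₁, hR, Finset.mem_filter, Finset.mem_Icc] at hn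
    rw [Nat.mem_smoothNumbersUpTo, Nat.mem_smoothNumbers']
    refine ⟨hn.1.1.2, fun p hp hpn => hn.2 p ?_⟩
    exact Nat.mem_primeFactors.2 ⟨hp, hpn, by omega⟩
  -- `R₂ ⊆ ⋃_{m ∈ M} m · Q(m)`
  have h2 : R₂ ⊆ M.biUnion (fun m => (Q m).image (fun p => m * p)) := by
    intro n hn
    simp only [hR₂, hR, Finset.mem_filter, Finset.mem_Icc] at hn
    obtain ⟨⟨⟨hn1, hnU⟩, hsmooth, hcop⟩, hnT, p₀, hp₀, hp₀k⟩ := hn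
    have hn0 : n ≠ 0 := by omega
    have hne : n.primeFactors.Nonempty := ⟨p₀, hp₀⟩
    have hpmem : n.primeFactors.max' hne ∈ n.primeFactors := Finset.max'_mem _ _
    set p := n.primeFactors.max' hne with hp
    have hpprime : p.Prime := Nat.prime_of_mem_primeFactors hpmem
    have hpn : p ∣ n := Nat.dvd_of_mem_primeFactors hpmem
    have hpk : k₁ ≤ p := hp₀k.trans (Finset.le_max' _ _ hp₀)
    have hpP : p ≤ P := hsmooth p hpmem
    have hmp : n / p * p = n := Nat.div_mul_cancel hpn
    set m := n / p with hm
    have hm1 : 1 ≤ m := (Nat.one_le_div_iff hpprime.pos).2 (Nat.le_of_dvd (by omega) hpn)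
    -- `n` is even (as `2 ∣ P#` and `(n − 1, P#) = 1`), `p` is odd, so `m` is even
    have hn_even : 2 ∣ n := by
      have h2P : 2 ∣ primorial P := Nat.prime_two.dvd_primorial_iff.2 hP
      have h21 : ¬ 2 ∣ n - 1 := fun h => by
        have h' := Nat.dvd_gcd h h2P
        rw [hcop.gcd_eq_one] at h'
        omega
      omega
    have hp_odd : ¬ 2 ∣ p := by
      intro h2
      have := (Nat.prime_dvd_prime_iff_eq Nat.prime_two hpprime).1 h2
      omega
    have hm_even : Even m := by
      have h2n : 2 ∣ m * p := by rw [hmp]; exact hn_even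
      rcases (Nat.Prime.dvd_mul Nat.prime_two).1 h2n with h | h
      · exact even_iff_two_dvd.2 h
      · exact absurd h hp_odd
    rw [Finset.mem_biUnion]
    refine ⟨m, ?_, ?_⟩
    · rw [hM]
      simp only [Finset.mem_filter, Finset.mem_Icc]
      refine ⟨⟨⟨⟨hm1, ?_⟩, ?_⟩, ?_⟩, hm_even⟩
      · calc m = n / p := hm
          _ ≤ n / k₁ := Nat.div_le_div_left hpk (by omega)
          _ ≤ Uf / k₁ := Nat.div_le_div_right hnU
      · rw [Nat.mem_smoothNumbers']
        intro q hq hqm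
        have hqn : q ∣ n := hqm.trans (Nat.div_dvd_of_dvd hpn)
        exact Nat.lt_succ_of_le (hsmooth q (Nat.mem_primeFactors.2 ⟨hq, hqn, hn0⟩))
      · have hP0 : (0 : ℝ) < P := by exact_mod_cast (by omega : 0 < P)
        rw [div_le_iff₀ hP0]
        have h : (n : ℝ) = (m : ℝ) * p := by rw [← hmp]; push_cast; ring
        have : (m : ℝ) * p ≤ (m : ℝ) * P :=
          mul_le_mul_of_nonneg_left (by exact_mod_cast hpP) (Nat.cast_nonneg m)
        linarith
    · rw [Finset.mem_image]
      refine ⟨p, ?_, hmp⟩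
      simp only [hQ, Finset.mem_filter, Finset.mem_Ioc]
      refine ⟨⟨⟨hpprime.pos, ?_⟩, hpprime⟩, ?_⟩
      · rw [Nat.le_div_iff_mul_le (by omega), mul_comm, hmp]; exact hnU
      · rw [hmp]; exact hcop.coprime_dvd_right (primorial_dvd_primorial (hYs m))
  -- combine
  have hcard : R.card ≤ R₀.card + (R₁.card + R₂.card) :=
    (Finset.card_le_card hcover).trans
      ((Finset.card_union_le _ _).trans (Nat.add_le_add_left (Finset.card_union_le _ _) _))
  have h2card : R₂.card ≤ ∑ m ∈ M, (Q m).card :=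
    (Finset.card_le_card h2).trans
      (Finset.card_biUnion_le.trans (Finset.sum_le_sum fun m _ => Finset.card_image_le))
  have h' : (R.card : ℝ) ≤ R₀.card + (R₁.card + R₂.card) := by exact_mod_cast hcard
  have h1' : (R₁.card : ℝ) ≤ (Nat.smoothNumbersUpTo Uf k₁).card := by exact_mod_cast h1
  have h2' : (R₂.card : ℝ) ≤ ∑ m ∈ M, (((Q m).card : ℕ) : ℝ) := by exact_mod_cast h2card
  linarith

/-! ### §5 The three estimates

Notation for the real parameters at one `x`: `L = log x`, `L₂ = log L`, `L₃ = log L₂`, `L₄ = log L₃`,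
`Λ = log y = (1 − ε) L L₃/L₂`, `U = C_U x Λ/L₂`, `w = L₃ − 2L₄` (so `e^w = L₂/L₃²`), `ℓ = log k₁` with
`k₁ = ⌊y^{1/8}⌋ + 1`. -/

/-- `e^c (e^a e^b) ≤ e^d` when `a + b + c ≤ d` (kept separate: `ring`/`linarith` must never compare
two `Real.exp` atoms). [folklore] -/
private theorem exp_mul_exp_mul_exp_le {a b c d : ℝ} (h : a + b + c ≤ d) :
    Real.exp c * (Real.exp a * Real.exp b) ≤ Real.exp d := by
  rw [← Real.exp_add, ← Real.exp_add]
  exact Real.exp_le_exp.2 (by linarith)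

/-- `e^a e^b ≤ e^d` when `a + b ≤ d`. [folklore] -/
private theorem exp_mul_exp_le {a b d : ℝ} (h : a + b ≤ d) :
    Real.exp a * Real.exp b ≤ Real.exp d := by
  rw [← Real.exp_add]
  exact Real.exp_le_exp.2 h

/-- `e^{L₃ − 2L₄} = L₂/L₃²`, `0 < w ≤ L₃`. [folklore] -/
private theorem w_facts {L₂ L₃ L₄ w : ℝ} (hL₃ : L₃ = Real.log L₂) (hL₄ : L₄ = Real.log L₃)
    (hw : w = L₃ - 2 * L₄) (hL₂ge : 100 ≤ L₂) (hL₄ge : 1 ≤ L₄) (hL₄le : 16 * L₄ ≤ L₃) :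
    Real.exp w = L₂ / L₃ ^ 2 ∧ 0 < w ∧ w ≤ L₃ := by
  have hL₂0 : 0 < L₂ := by linarith
  have hL₃0 : 0 < L₃ := by linarith
  refine ⟨?_, by linarith, by linarith⟩
  rw [hw, Real.exp_sub, hL₄, show 2 * Real.log L₃ = Real.log (L₃ ^ 2) by
    rw [Real.log_pow]; norm_num, Real.exp_log (pow_pos hL₃0 2), hL₃, Real.exp_log hL₂0]

set_option maxHeartbeats 400000 in
/-- **The `k₁`-smooth part** (`k₁ ≈ y^{1/8}`): by Rankin's bound `Ψ(U, k₁) ≤ U^{1−η₁} ∏_{p<k₁}(1 − p^{−(1−η₁)})⁻¹`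
with `η₁ = w/log k₁`, `k₁^{η₁} = e^w = L₂/L₃²`, the sharp Euler product and `U^{η₁} ≥ L^{7/2}`:
`Ψ(⌊U⌋, k₁) ≤ x/(log x)^{1+ε}` for `ε ≤ 1/4`. [cite: Maynard2016LargeGaps, §2, Lemma 2;
MaierPomerance1990, Thm 5.3 (proof, the `y^{1/2}`-smooth part)] -/
theorem smooth_part_le {ε C_U X L L₂ L₃ L₄ Λ Uv w ℓ : ℝ} {Uf k₁ : ℕ}
    (hL₂ : L₂ = Real.log L) (hL₃ : L₃ = Real.log L₂) (hL₄ : L₄ = Real.log L₃)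
    (hε0 : 0 < ε) (hε : ε ≤ 1 / 4) (hCU : 0 < C_U) (hX : 0 < X)
    (hΛ : Λ = (1 - ε) * (L * L₃ / L₂)) (hUv : Uv = C_U * (X * Λ / L₂)) (hUf : (Uf : ℝ) ≤ Uv)
    (hXU : X ≤ Uv) (hk₁ : 2 ≤ k₁) (hℓ : ℓ = Real.log k₁) (hℓlo : Λ / 8 ≤ ℓ)
    (hℓhi : ℓ ≤ Λ / 8 + Real.log 2) (hw : w = L₃ - 2 * L₄)
    (hLX : L = Real.log X) (hL₂ge : 100 ≤ L₂) (hL₃ge : 24 ≤ L₃) (hL₄ge : 1 ≤ L₄)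
    (hL₄le : 16 * L₄ ≤ L₃) (hL₃L₂ : 2 * L₃ ≤ L₂) (hLL₂ : 6 * L₂ ^ 2 ≤ L)
    (hCU12 : 8 * (Real.log C_U + 12) ≤ L₂) :
    ((Nat.smoothNumbersUpTo Uf k₁).card : ℝ) ≤ X / L ^ (1 + ε) := by
  have hL₂0 : 0 < L₂ := by linarith
  have hL₃0 : 0 < L₃ := by linarith
  have hL0 : 0 < L := by nlinarith
  have hLexp : Real.exp L₂ = L := by rw [hL₂, Real.exp_log hL0]
  obtain ⟨hew, hw0, hwL₃⟩ := w_facts hL₃ hL₄ hw hL₂ge hL₄ge hL₄le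
  have hA0 : 0 ≤ L * L₃ / L₂ := by positivity
  have hΛA : Λ ≤ L * L₃ / L₂ := by
    have h1 : (1 - ε) * (L * L₃ / L₂) = L * L₃ / L₂ - ε * (L * L₃ / L₂) := by ring
    rw [hΛ, h1]
    linarith [mul_nonneg hε0.le hA0]
  -- `Λ ≥ 108 L₂`, `Λ ≤ L`
  have hΛlo : 108 * L₂ ≤ Λ := by
    have hA : 144 * L₂ ≤ L * L₃ / L₂ := by
      rw [le_div_iff₀ hL₂0]
      have := mul_le_mul hLL₂ hL₃ge (by norm_num) hL0.le
      nlinarith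
    have h1 : (3 : ℝ) / 4 ≤ 1 - ε := by linarith
    have h2 : (3 : ℝ) / 4 * (144 * L₂) ≤ (1 - ε) * (L * L₃ / L₂) :=
      mul_le_mul h1 hA (by positivity) (by linarith)
    rw [hΛ]; linarith
  have hΛL : Λ ≤ L := by
    have h2 : L * L₃ / L₂ ≤ L := by
      rw [div_le_iff₀ hL₂0]
      exact mul_le_mul_of_nonneg_left (by linarith) hL0.le
    linarith
  have hΛ0 : 0 < Λ := by linarith
  have hlog2 : Real.log 2 ≤ 1 := by
    have := Real.log_two_lt_d9; linarith
  have hℓ0 : 0 < ℓ := by linarith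
  have hℓΛ : ℓ ≤ Λ / 4 := by linarith
  -- `η₁`
  set η₁ := w / ℓ with hη₁
  have hη₁0 : 0 < η₁ := div_pos hw0 hℓ0
  have hη₁le : η₁ ≤ 1 / 4 := by
    rw [hη₁, div_le_iff₀ hℓ0]; linarith
  have hη₁ℓ : η₁ * ℓ = w := by rw [hη₁, div_mul_cancel₀ _ hℓ0.ne']
  have hk₁0 : (0 : ℝ) < k₁ := by exact_mod_cast (by omega : 0 < k₁)
  -- the Euler exponent: `η₁ (L₂/L₃²) (ℓ + 2) ≤ L₂/12`
  have hEexp : η₁ * (L₂ / L₃ ^ 2) * (ℓ + 2) ≤ L₂ / 12 := by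
    have h2ℓ : ℓ + 2 ≤ 2 * ℓ := by linarith
    have h3 : w * (L₂ / L₃ ^ 2) ≤ L₂ / L₃ := by
      calc w * (L₂ / L₃ ^ 2) ≤ L₃ * (L₂ / L₃ ^ 2) :=
            mul_le_mul_of_nonneg_right hwL₃ (by positivity)
        _ = L₂ / L₃ := by field_simp
    have h4 : L₂ / L₃ ≤ L₂ / 24 := div_le_div_of_nonneg_left hL₂0.le (by norm_num) hL₃ge
    calc η₁ * (L₂ / L₃ ^ 2) * (ℓ + 2) ≤ η₁ * (L₂ / L₃ ^ 2) * (2 * ℓ) :=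
          mul_le_mul_of_nonneg_left h2ℓ (by positivity)
      _ = 2 * (η₁ * ℓ) * (L₂ / L₃ ^ 2) := by ring
      _ = 2 * (w * (L₂ / L₃ ^ 2)) := by rw [hη₁ℓ]; ring
      _ ≤ L₂ / 12 := by linarith
  -- `U^{1-η₁} ≤ U e^{-7L₂/2}`
  have hUv0 : 0 < Uv := lt_of_lt_of_le hX hXU
  have hηL : (7 : ℝ) / 2 * L₂ ≤ η₁ * Real.log Uv := by
    have h1 : L ≤ Real.log Uv := by rw [hLX]; exact Real.log_le_log hX hXU
    have h2 : η₁ * L ≤ η₁ * Real.log Uv := mul_le_mul_of_nonneg_left h1 hη₁0.le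
    -- `η₁ L = wL/ℓ ≥ 4wL/Λ ≥ 4 w L₂/L₃ ≥ 7L₂/2`
    have h6 : L₂ * Λ ≤ L * L₃ := by
      have := mul_le_mul_of_nonneg_left hΛA hL₂0.le
      rwa [mul_div_cancel₀ _ hL₂0.ne'] at this
    have h4 : 4 * L₂ * ℓ ≤ L * L₃ := by
      have := mul_le_mul_of_nonneg_left hℓΛ hL₂0.le
      linarith
    have h3 : 4 * w * L₂ / L₃ ≤ η₁ * L := by
      rw [hη₁, div_mul_eq_mul_div, div_le_div_iff₀ hL₃0 hℓ0]
      have := mul_le_mul_of_nonneg_left h4 hw0.le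
      linarith
    have h5 : (7 : ℝ) / 2 * L₂ ≤ 4 * w * L₂ / L₃ := by
      rw [le_div_iff₀ hL₃0, hw]
      have := mul_le_mul_of_nonneg_left hL₄le hL₂0.le
      nlinarith [this]
    linarith only [h2, h3, h5]
  have hUpow : Uv ^ (1 - η₁) ≤ Uv * Real.exp (-((7 : ℝ) / 2 * L₂)) := by
    rw [Real.rpow_def_of_pos hUv0, show Real.log Uv * (1 - η₁) = Real.log Uv + -(η₁ * Real.log Uv) by
      ring, Real.exp_add, Real.exp_log hUv0]
    exact mul_le_mul_of_nonneg_left (Real.exp_le_exp.2 (by linarith)) hUv0.le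
  have hUfpow : (Uf : ℝ) ^ (1 - η₁) ≤ Uv ^ (1 - η₁) :=
    Real.rpow_le_rpow (Nat.cast_nonneg Uf) hUf (by linarith)
  -- Rankin + Euler
  have hR := card_smoothNumbersUpTo_le_rankin Uf k₁ (σ := 1 - η₁) (by linarith)
  have hE := prod_primesBelow_inv_one_sub_rpow_le_exp_loglog k₁ hk₁ hη₁0 hη₁le
  rw [← hℓ] at hE
  have hkη : (k₁ : ℝ) ^ η₁ = L₂ / L₃ ^ 2 := by
    rw [Real.rpow_def_of_pos hk₁0, ← hℓ, mul_comm, hη₁ℓ, hew]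
  rw [hkη] at hE
  have hprod0 : 0 ≤ ∏ p ∈ k₁.primesBelow, (1 - (p : ℝ) ^ (-(1 - η₁)))⁻¹ :=
    Finset.prod_nonneg fun p hp => inv_nonneg.2 (by
      have hp2 : (2 : ℝ) ≤ p := by exact_mod_cast (Nat.prime_of_mem_primesBelow hp).two_le
      have : (p : ℝ) ^ (-(1 - η₁)) ≤ 1 :=
        Real.rpow_le_one_of_one_le_of_nonpos (by linarith) (by linarith)
      linarith)
  -- assemble: `card ≤ U e^{-7L₂/2} · ℓ e^{12 + L₂/12}`
  have hexpℓ : Real.exp (Real.log ℓ + 12 + L₂ / 12) = ℓ * Real.exp (12 + L₂ / 12) := by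
    rw [add_assoc, Real.exp_add, Real.exp_log hℓ0]
  have hstep1 : ((Nat.smoothNumbersUpTo Uf k₁).card : ℝ) ≤
      Uv * Real.exp (-((7 : ℝ) / 2 * L₂)) * (ℓ * Real.exp (12 + L₂ / 12)) := by
    rw [← hexpℓ]
    exact hR.trans (mul_le_mul (hUfpow.trans hUpow)
      (hE.trans (Real.exp_le_exp.2 (by linarith only [hEexp]))) hprod0 (by positivity))
  -- compare with `X/L^{1+ε} = X e^{-(1+ε)L₂}`
  have htarget : X / L ^ (1 + ε) = X * Real.exp (-((1 + ε) * L₂)) := by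
    rw [Real.rpow_def_of_pos hL0, ← hL₂, Real.exp_neg, div_eq_mul_inv, mul_comm (1 + ε) L₂]
  rw [htarget]
  refine hstep1.trans ?_
  -- `U ℓ ≤ C_U X L²/L₂ ≤ C_U X L² = X e^{log C_U + 2 L₂}`
  have hUvle : Uv ≤ C_U * X * L / L₂ := by
    rw [hUv]
    have : X * Λ / L₂ ≤ X * L / L₂ :=
      div_le_div_of_nonneg_right (mul_le_mul_of_nonneg_left hΛL hX.le) hL₂0.le
    calc C_U * (X * Λ / L₂) ≤ C_U * (X * L / L₂) := mul_le_mul_of_nonneg_left this hCU.le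
      _ = C_U * X * L / L₂ := by ring
  have hℓL : ℓ ≤ L := by linarith only [hℓhi, hlog2, hΛL, hΛlo, hL₂ge]
  have h2 : Uv * ℓ ≤ X * Real.exp (Real.log C_U + 2 * L₂) := by
    have h0 : (0 : ℝ) ≤ C_U * X * L / L₂ := by positivity
    have h3 : Uv * ℓ ≤ C_U * X * L / L₂ * L := mul_le_mul hUvle hℓL hℓ0.le h0
    have h4 : C_U * X * L / L₂ * L ≤ C_U * X * L * L :=
      mul_le_mul_of_nonneg_right (div_le_self (by positivity) (by linarith)) hL0.le
    have h5 : C_U * X * L * L = X * Real.exp (Real.log C_U + 2 * L₂) := by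
      rw [Real.exp_add, Real.exp_log hCU, show 2 * L₂ = L₂ + L₂ by ring, Real.exp_add, hLexp]
      ring
    linarith only [h3, h4, h5]
  have hexp : -((7 : ℝ) / 2 * L₂) + (12 + L₂ / 12) + (Real.log C_U + 2 * L₂) ≤ -((1 + ε) * L₂) := by
    have := mul_le_mul_of_nonneg_right hε hL₂0.le
    linarith only [this, hCU12, hL₂0]
  calc Uv * Real.exp (-((7 : ℝ) / 2 * L₂)) * (ℓ * Real.exp (12 + L₂ / 12))
      = Uv * ℓ * (Real.exp (-((7 : ℝ) / 2 * L₂)) * Real.exp (12 + L₂ / 12)) := mul_mul_mul_comm _ _ _ _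
    _ ≤ X * Real.exp (Real.log C_U + 2 * L₂) *
          (Real.exp (-((7 : ℝ) / 2 * L₂)) * Real.exp (12 + L₂ / 12)) :=
        mul_le_mul_of_nonneg_right h2 (mul_nonneg (Real.exp_pos _).le (Real.exp_pos _).le)
    _ = X * (Real.exp (Real.log C_U + 2 * L₂) *
          (Real.exp (-((7 : ℝ) / 2 * L₂)) * Real.exp (12 + L₂ / 12))) := mul_assoc _ _ _
    _ ≤ X * Real.exp (-((1 + ε) * L₂)) :=
        mul_le_mul_of_nonneg_left (exp_mul_exp_mul_exp_le hexp) hX.le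

/-- `a (b c) ≤ e^{x+y+z}` from `a ≤ e^x`, `b ≤ e^y`, `c ≤ e^z` (`b, c ≥ 0`). [folklore] -/
private theorem mul_mul_le_exp {a b c x y z : ℝ} (ha : a ≤ Real.exp x) (hb : b ≤ Real.exp y)
    (hc : c ≤ Real.exp z) (hb0 : 0 ≤ b) (hc0 : 0 ≤ c) : a * (b * c) ≤ Real.exp (x + y + z) := by
  rw [add_assoc, Real.exp_add, Real.exp_add]
  exact mul_le_mul ha (mul_le_mul hb hc hc0 (Real.exp_pos _).le) (mul_nonneg hb0 hc0)
    (Real.exp_pos _).le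

/-- **The exponent of Rankin's tail** (pure inequality): with `η = w/Λ`, `w = L₃ − 2L₄`,
`Λ = (1 − ε) L L₃/L₂`, `log T = L − (1 + ε) L₂`:
`η log T ≥ (1 + ε) L₂ + ε² L₂ − 4 L₄L₂/L₃ − 1` (the saving `ε² L₂` comes from `1/(1 − ε) ≥ 1 + ε + ε²`).
[cite: MaierPomerance1990, Thm 5.3 (proof, choice of parameters)] -/
private theorem key_exponent {ε L L₂ L₃ L₄ Λ w η logT Q : ℝ} (hε0 : 0 < ε) (hε : ε ≤ 1 / 4)
    (hΛ : Λ = (1 - ε) * (L * L₃ / L₂)) (hw : w = L₃ - 2 * L₄) (hη : η = w / Λ)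
    (hlogT : logT = L - (1 + ε) * L₂) (hQ : Q = L₄ * L₂ / L₃) (hL₂ge : 100 ≤ L₂) (hL₃ge : 24 ≤ L₃)
    (hL₄ge : 1 ≤ L₄) (hL₄le : 16 * L₄ ≤ L₃) (hLL₂ : 6 * L₂ ^ 2 ≤ L) :
    (1 + ε) * L₂ + ε ^ 2 * L₂ - 4 * Q - 1 ≤ η * logT := by
  have hL₂0 : 0 < L₂ := by linarith
  have hL₃0 : 0 < L₃ := by linarith
  have hL0 : 0 < L := by nlinarith
  have hw0 : 0 < w := by rw [hw]; linarith
  have hwL₃ : w ≤ L₃ := by rw [hw]; linarith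
  have hQ0 : 0 ≤ Q := by rw [hQ]; positivity
  -- `L₂ Λ = (1 - ε) L L₃` and `Λ ≥ (9/2) L₂ L₃`
  have h6 : L₂ * Λ = (1 - ε) * L * L₃ := by rw [hΛ]; field_simp
  have hΛlo : (9 : ℝ) / 2 * (L₂ * L₃) ≤ Λ := by
    have h1 : (3 : ℝ) / 4 ≤ 1 - ε := by linarith
    have h2 : 6 * L₂ * L₃ ≤ L * L₃ / L₂ := by
      rw [le_div_iff₀ hL₂0]; nlinarith [mul_le_mul_of_nonneg_right hLL₂ hL₃0.le]
    have h3 : (3 : ℝ) / 4 * (6 * L₂ * L₃) ≤ (1 - ε) * (L * L₃ / L₂) :=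
      mul_le_mul h1 h2 (by positivity) (by linarith)
    rw [hΛ]; linarith
  have hΛ0 : 0 < Λ := by nlinarith [mul_pos hL₂0 hL₃0]
  have hη0 : 0 ≤ η := by rw [hη]; positivity
  -- (i) `η (1+ε) L₂ ≤ 1`
  have hi : η * ((1 + ε) * L₂) ≤ 1 := by
    rw [hη, div_mul_eq_mul_div, div_le_one hΛ0]
    have : w * ((1 + ε) * L₂) ≤ L₃ * ((5 : ℝ) / 4 * L₂) :=
      mul_le_mul hwL₃ (by nlinarith) (by positivity) hL₃0.le
    nlinarith [mul_pos hL₂0 hL₃0]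
  -- (ii) `η L ≥ (1 + ε + ε²) w L₂/L₃`
  have hii : (1 + ε + ε ^ 2) * w * L₂ / L₃ ≤ η * L := by
    rw [hη, div_mul_eq_mul_div, div_le_div_iff₀ hL₃0 hΛ0]
    have h7 : (1 + ε + ε ^ 2) * w * L₂ * Λ = (1 - ε ^ 3) * (w * L * L₃) := by
      rw [show (1 + ε + ε ^ 2) * w * L₂ * Λ = (1 + ε + ε ^ 2) * w * (L₂ * Λ) by ring, h6]; ring
    rw [h7]
    have hpos : 0 ≤ ε ^ 3 * (w * L * L₃) :=
      mul_nonneg (pow_nonneg hε0.le 3) (mul_nonneg (mul_nonneg hw0.le hL0.le) hL₃0.le)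
    nlinarith [hpos]
  -- (iii) `w L₂/L₃ = L₂ − 2Q`
  have hiii : w * L₂ / L₃ = L₂ - 2 * Q := by
    rw [hw, hQ]; field_simp
  have hiii' : (1 + ε + ε ^ 2) * w * L₂ / L₃ = (1 + ε + ε ^ 2) * (L₂ - 2 * Q) := by
    rw [← hiii]; ring
  -- combine
  have hεQ : ε * Q ≤ 1 / 4 * Q := mul_le_mul_of_nonneg_right hε hQ0
  have hε2 : ε ^ 2 ≤ 1 / 16 := by nlinarith
  have hε2Q : ε ^ 2 * Q ≤ 1 / 16 * Q := mul_le_mul_of_nonneg_right hε2 hQ0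
  have hεQ0 : 0 ≤ ε * Q := mul_nonneg hε0.le hQ0
  have hε2Q0 : 0 ≤ ε ^ 2 * Q := mul_nonneg (pow_nonneg hε0.le 2) hQ0
  have hmain : η * logT = η * L - η * ((1 + ε) * L₂) := by rw [hlogT]; ring
  rw [hmain]
  have hexpand : (1 + ε + ε ^ 2) * (L₂ - 2 * Q) =
      (1 + ε) * L₂ + ε ^ 2 * L₂ - 2 * Q - 2 * (ε * Q) - 2 * (ε ^ 2 * Q) := by ring
  linarith [hii, hiii', hexpand, hi, hεQ, hε2Q, hεQ0, hε2Q0]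

set_option maxHeartbeats 400000 in
/-- **The sifted part** (the integers `n = mp`, `p = P⁺(n) ≥ k₁`): given the sieve bound
`#{p ≤ U/m : (mp − 1, P_{z_m}) = 1} ≤ B U/(m log² k₁)` for the even `y`-smooth `m ∈ (T/P, U/k₁]`,
Rankin's bound for the harmonic tail `∑_{m > T/P, m y-smooth} 1/m ≤ (T/P)^{−η} ∏_{p ≤ y}(1 − p^{η−1})⁻¹`
with `η = (L₃ − 2L₄)/log y` and the sharp Euler product give `∑_m ≤ x/(log x)^{1+ε}`.
[cite: Maynard2016LargeGaps, §2, Lemma 2; MaierPomerance1990, Thm 5.3 (proof);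
Tenenbaum2015, Ch. III.5 §5.1] -/
theorem sifted_part_le {ε C_U X L L₂ L₃ L₄ Λ Uv w ℓ T B c_B : ℝ} {Uf k₁ P : ℕ}
    (M : Finset ℕ) (F : ℕ → ℝ)
    (hF : ∀ m ∈ M, F m ≤ B * (Uv / m) / ℓ ^ 2)
    (hMsub : M ⊆ ((Finset.Icc 1 (Uf / k₁)).filter (· ∈ Nat.smoothNumbers (P + 1))).filter
      (fun m : ℕ => T / P ≤ (m : ℝ)))
    (hL₂ : L₂ = Real.log L) (hL₃ : L₃ = Real.log L₂) (hL₄ : L₄ = Real.log L₃)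
    (hε0 : 0 < ε) (hε : ε ≤ 1 / 4) (hCU : 0 < C_U) (hX : 0 < X)
    (hΛ : Λ = (1 - ε) * (L * L₃ / L₂)) (hUv : Uv = C_U * (X * Λ / L₂))
    (hP2 : 2 ≤ P) (hPΛ : Real.log P ≤ Λ) (hP1Λ : Real.log ((P : ℝ) + 1) ≤ Λ + 1)
    (hT0 : 0 < T) (hT : Real.log T = L - (1 + ε) * L₂) (hTP : 1 ≤ T / P)
    (hℓlo : Λ / 8 ≤ ℓ) (hw : w = L₃ - 2 * L₄)
    (hB0 : 0 ≤ B) (hBle : B ≤ c_B * L₂ ^ 2) (hcB : 0 < c_B)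
    (hL₂ge : 100 ≤ L₂) (hL₃ge : 24 ≤ L₃) (hL₄ge : 1 ≤ L₄) (hL₃L₂ : 2 * L₃ ≤ L₂)
    (hLL₂ : 6 * L₂ ^ 2 ≤ L) (hg1 : 16 * L₄ ≤ ε ^ 2 * L₃) (hg2 : 24 ≤ ε ^ 2 * L₃)
    (hg3 : 8 * L₃ ≤ ε ^ 2 * L₂) (hg4 : 4 * (Real.log (128 * c_B * C_U) + 13) ≤ ε ^ 2 * L₂) :
    ∑ m ∈ M, F m ≤ X / L ^ (1 + ε) := by
  have hL₂0 : 0 < L₂ := by linarith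
  have hL₃0 : 0 < L₃ := by linarith
  have hL0 : 0 < L := by nlinarith
  have hε21 : ε ^ 2 ≤ 1 := by nlinarith
  have hL₄le : 16 * L₄ ≤ L₃ := le_trans hg1 (by nlinarith)
  have hL₂exp : Real.exp L₃ = L₂ := by rw [hL₃, Real.exp_log hL₂0]
  obtain ⟨hew, hw0, hwL₃⟩ := w_facts hL₃ hL₄ hw hL₂ge hL₄ge hL₄le
  have hA0 : 0 ≤ L * L₃ / L₂ := by positivity
  have hΛA : Λ ≤ L * L₃ / L₂ := by
    have h1 : (1 - ε) * (L * L₃ / L₂) = L * L₃ / L₂ - ε * (L * L₃ / L₂) := by ring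
    rw [hΛ, h1]
    linarith [mul_nonneg hε0.le hA0]
  have hΛlo : 108 * L₂ ≤ Λ := by
    have hA : 144 * L₂ ≤ L * L₃ / L₂ := by
      rw [le_div_iff₀ hL₂0]
      have := mul_le_mul hLL₂ hL₃ge (by norm_num) hL0.le
      nlinarith
    have h1 : (3 : ℝ) / 4 ≤ 1 - ε := by linarith
    have h2 : (3 : ℝ) / 4 * (144 * L₂) ≤ (1 - ε) * (L * L₃ / L₂) :=
      mul_le_mul h1 hA (by positivity) (by linarith)
    rw [hΛ]; linarith
  have hΛ0 : 0 < Λ := by linarith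
  have hℓ0 : 0 < ℓ := by linarith
  have hP0 : (0 : ℝ) < P := by exact_mod_cast (by omega : 0 < P)
  have hP1pos : (0 : ℝ) < (P : ℝ) + 1 := Nat.cast_add_one_pos P
  have hP2r : (2 : ℝ) ≤ P := by exact_mod_cast hP2
  have hlogP1 : 0 < Real.log ((P : ℝ) + 1) := Real.log_pos (by linarith only [hP2r])
  have hL23 : 0 ≤ L₂ / L₃ ^ 2 := div_nonneg hL₂0.le (sq_nonneg L₃)
  -- algebra: `(B U/ℓ²) · 2Λ ≤ 128 B C_U X/L₂ ≤ X · exp(log(128 c_B C_U) + L₃)`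
  have hBUv : 0 ≤ B * Uv := by
    rw [hUv]; exact mul_nonneg hB0 (mul_nonneg hCU.le (div_nonneg (mul_nonneg hX.le hΛ0.le) hL₂0.le))
  have hBU0 : 0 ≤ B * Uv / ℓ ^ 2 := div_nonneg hBUv (sq_nonneg ℓ)
  have hF1 : B * Uv / ℓ ^ 2 * (2 * Λ) ≤ X * Real.exp (Real.log (128 * c_B * C_U) + L₃) := by
    have hℓ2 : Λ ^ 2 / 64 ≤ ℓ ^ 2 := by
      have h0 : 0 ≤ Λ / 8 := by linarith only [hΛ0]
      have h := mul_le_mul hℓlo hℓlo h0 hℓ0.le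
      have e1 : Λ ^ 2 / 64 = Λ / 8 * (Λ / 8) := by ring
      have e2 : ℓ ^ 2 = ℓ * ℓ := by ring
      rw [e1, e2]; exact h
    have h3 : B * Uv / ℓ ^ 2 * (2 * Λ) ≤ B * Uv / (Λ ^ 2 / 64) * (2 * Λ) :=
      mul_le_mul_of_nonneg_right (div_le_div_of_nonneg_left hBUv
        (div_pos (pow_pos hΛ0 2) (by norm_num)) hℓ2) (by linarith only [hΛ0])
    have h4 : B * Uv / (Λ ^ 2 / 64) * (2 * Λ) = 128 * B * C_U * X / L₂ := by
      rw [hUv]; field_simp; ring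
    have h5 : 128 * B * C_U * X / L₂ ≤ 128 * (c_B * L₂ ^ 2) * C_U * X / L₂ := by
      refine div_le_div_of_nonneg_right ?_ hL₂0.le
      have h0 : 0 ≤ 128 * C_U * X := mul_nonneg (mul_nonneg (by norm_num) hCU.le) hX.le
      have h6 := mul_le_mul_of_nonneg_left hBle h0
      linarith only [h6]
    have h6 : 128 * (c_B * L₂ ^ 2) * C_U * X / L₂ = X * (128 * c_B * C_U * L₂) := by
      field_simp
    have h7 : 128 * c_B * C_U * L₂ = Real.exp (Real.log (128 * c_B * C_U) + L₃) := by
      rw [Real.exp_add, Real.exp_log (mul_pos (mul_pos (by norm_num) hcB) hCU), hL₂exp]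
    calc B * Uv / ℓ ^ 2 * (2 * Λ) ≤ 128 * B * C_U * X / L₂ := h3.trans (le_of_eq h4)
      _ ≤ X * (128 * c_B * C_U * L₂) := h5.trans (le_of_eq h6)
      _ = X * Real.exp (Real.log (128 * c_B * C_U) + L₃) := by rw [h7]
  -- the final exponent (with `Q = L₄L₂/L₃`)
  set Q := L₄ * L₂ / L₃ with hQ
  have hfin : Real.log (128 * c_B * C_U) + L₃ + (w + 1 + 4 * Q - (1 + ε) * L₂ - ε ^ 2 * L₂) +
      (12 + 6 * L₂ / L₃) ≤ -((1 + ε) * L₂) := by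
    have hQle : 4 * Q ≤ ε ^ 2 * L₂ / 4 := by
      rw [hQ, show 4 * (L₄ * L₂ / L₃) = (4 * L₄ * L₂) / L₃ by ring, div_le_iff₀ hL₃0]
      have := mul_le_mul_of_nonneg_left hg1 hL₂0.le
      linarith only [this]
    have h62 : 6 * L₂ / L₃ ≤ ε ^ 2 * L₂ / 4 := by
      rw [div_le_iff₀ hL₃0]
      have := mul_le_mul_of_nonneg_left hg2 hL₂0.le
      linarith only [this]
    linarith only [hQle, h62, hg3, hg4, hwL₃]
  have htarget : X / L ^ (1 + ε) = X * Real.exp (-((1 + ε) * L₂)) := by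
    rw [Real.rpow_def_of_pos hL0, ← hL₂, Real.exp_neg, div_eq_mul_inv, mul_comm (1 + ε) L₂]
  -- `η`
  set η := w / Λ with hη
  have hη0 : 0 < η := div_pos hw0 hΛ0
  have hηle : η ≤ 1 / 4 := by rw [hη, div_le_iff₀ hΛ0]; linarith
  have hηΛ : η * Λ = w := by rw [hη, div_mul_cancel₀ _ hΛ0.ne']
  -- numerics of the Euler exponent: `(P+1)^η ≤ 3 L₂/L₃²`, `η (P+1)^η (log(P+1)+2) ≤ 6 L₂/L₃`
  have hPη : ((P : ℝ) + 1) ^ η ≤ 3 * (L₂ / L₃ ^ 2) := by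
    rw [Real.rpow_def_of_pos hP1pos, ← hew]
    have h3 : Real.log ((P : ℝ) + 1) * η ≤ w + 1 := by
      have h4 := mul_le_mul_of_nonneg_right hP1Λ hη0.le
      have h5 : (Λ + 1) * η = η * Λ + η := by ring
      linarith only [h4, h5, hηΛ, hηle]
    have h6 : Real.exp 1 ≤ 3 := le_of_lt (lt_trans Real.exp_one_lt_d9 (by norm_num))
    calc Real.exp (Real.log ((P : ℝ) + 1) * η) ≤ Real.exp (w + 1) := Real.exp_le_exp.2 h3
      _ = Real.exp w * Real.exp 1 := Real.exp_add _ _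
      _ ≤ Real.exp w * 3 := mul_le_mul_of_nonneg_left h6 (Real.exp_pos _).le
      _ = 3 * Real.exp w := mul_comm _ _
  have hEexp : η * ((P : ℝ) + 1) ^ η * (Real.log ((P : ℝ) + 1) + 2) ≤ 6 * L₂ / L₃ := by
    have h3 : Real.log ((P : ℝ) + 1) + 2 ≤ 2 * Λ := by linarith only [hP1Λ, hΛlo, hL₂ge]
    have h4 : η * ((P : ℝ) + 1) ^ η ≤ η * (3 * (L₂ / L₃ ^ 2)) := mul_le_mul_of_nonneg_left hPη hη0.le
    have h30 : (0 : ℝ) ≤ 3 * (L₂ / L₃ ^ 2) := mul_nonneg (by norm_num) hL23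
    have h5 : η * ((P : ℝ) + 1) ^ η * (Real.log ((P : ℝ) + 1) + 2) ≤
        η * (3 * (L₂ / L₃ ^ 2)) * (2 * Λ) :=
      mul_le_mul h4 h3 (by linarith only [hlogP1]) (mul_nonneg hη0.le h30)
    have h6 : η * (3 * (L₂ / L₃ ^ 2)) * (2 * Λ) = 6 * (η * Λ) * (L₂ / L₃ ^ 2) := by ring
    rw [h6, hηΛ] at h5
    have h7 : 6 * w * (L₂ / L₃ ^ 2) ≤ 6 * L₃ * (L₂ / L₃ ^ 2) :=
      mul_le_mul_of_nonneg_right (by linarith only [hwL₃]) hL23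
    have h8 : 6 * L₃ * (L₂ / L₃ ^ 2) = 6 * L₂ / L₃ := by field_simp
    linarith only [h5, h7, h8]
  -- the tail exponent: `(T/P)^{-η} ≤ exp(w + 1 + 4Q − (1+ε)L₂ − ε²L₂)`
  have hkey := key_exponent hε0 hε hΛ hw hη hT hQ hL₂ge hL₃ge hL₄ge hL₄le hLL₂
  have hTP0 : 0 < T / P := div_pos hT0 hP0
  have hTPη0 : 0 ≤ (T / P) ^ (-η) := Real.rpow_nonneg hTP0.le _
  have hF2 : (T / P) ^ (-η) ≤ Real.exp (w + 1 + 4 * Q - (1 + ε) * L₂ - ε ^ 2 * L₂) := by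
    rw [Real.rpow_def_of_pos hTP0, Real.log_div hT0.ne' hP0.ne']
    refine Real.exp_le_exp.2 ?_
    have h3 : (Real.log T - Real.log P) * -η = -(η * Real.log T) + η * Real.log P := by ring
    rw [h3]
    have h4 : η * Real.log P ≤ w := by
      calc η * Real.log P ≤ η * Λ := mul_le_mul_of_nonneg_left hPΛ hη0.le
        _ = w := hηΛ
    linarith only [hkey, h4]
  -- Step 1: `∑ F ≤ (B U/ℓ²) ∑_{M} 1/m`
  have h1 : ∑ m ∈ M, F m ≤ B * Uv / ℓ ^ 2 * ∑ m ∈ M, (1 : ℝ) / m := by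
    rw [Finset.mul_sum]
    refine Finset.sum_le_sum fun m hm => (hF m hm).trans (le_of_eq ?_)
    ring
  -- Step 2: Rankin's harmonic tail
  have h2 : ∑ m ∈ M, (1 : ℝ) / m ≤ (T / P) ^ (-η) *
      ∏ p ∈ (P + 1).primesBelow, (1 - (p : ℝ) ^ (-(1 - η)))⁻¹ := by
    have h := Literature.NumberTheory.Multiplicative.SmoothRankin.sum_inv_smooth_tail_le (P + 1)
      (Uf / k₁) hη0.le (by linarith only [hηle]) hTP
    have hcongr : ∏ p ∈ (P + 1).primesBelow, (1 - (p : ℝ) ^ (η - 1))⁻¹ =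
        ∏ p ∈ (P + 1).primesBelow, (1 - (p : ℝ) ^ (-(1 - η)))⁻¹ :=
      Finset.prod_congr rfl fun p _ => by rw [neg_sub]
    rw [hcongr] at h
    exact (Finset.sum_le_sum_of_subset_of_nonneg hMsub fun m _ _ =>
      Nat.one_div_cast_nonneg m).trans h
  -- Step 3: the Euler product
  have hP12 : 2 ≤ P + 1 := by omega
  have hE := prod_primesBelow_inv_one_sub_rpow_le_exp_loglog (P + 1) hP12 hη0 hηle
  push_cast at hE
  have hprod : ∏ p ∈ (P + 1).primesBelow, (1 - (p : ℝ) ^ (-(1 - η)))⁻¹ ≤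
      2 * Λ * Real.exp (12 + 6 * L₂ / L₃) := by
    refine hE.trans ?_
    rw [add_assoc, Real.exp_add (Real.log (Real.log ((P : ℝ) + 1))), Real.exp_log hlogP1]
    exact mul_le_mul (by linarith only [hP1Λ, hΛlo, hL₂ge]) (Real.exp_le_exp.2
      (by linarith only [hEexp])) (Real.exp_pos _).le (by linarith only [hΛ0])
  -- Step 4: combine
  have hstep : ∑ m ∈ M, F m ≤ B * Uv / ℓ ^ 2 * (2 * Λ) *
      ((T / P) ^ (-η) * Real.exp (12 + 6 * L₂ / L₃)) := by
    calc ∑ m ∈ M, F m ≤ B * Uv / ℓ ^ 2 * ∑ m ∈ M, (1 : ℝ) / m := h1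
      _ ≤ B * Uv / ℓ ^ 2 * ((T / P) ^ (-η) *
            ∏ p ∈ (P + 1).primesBelow, (1 - (p : ℝ) ^ (-(1 - η)))⁻¹) :=
          mul_le_mul_of_nonneg_left h2 hBU0
      _ ≤ B * Uv / ℓ ^ 2 * ((T / P) ^ (-η) * (2 * Λ * Real.exp (12 + 6 * L₂ / L₃))) :=
          mul_le_mul_of_nonneg_left (mul_le_mul_of_nonneg_left hprod hTPη0) hBU0
      _ = B * Uv / ℓ ^ 2 * (2 * Λ) * ((T / P) ^ (-η) * Real.exp (12 + 6 * L₂ / L₃)) := by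
          generalize (T / (P : ℝ)) ^ (-η) = R
          generalize Real.exp (12 + 6 * L₂ / L₃) = E
          ring
  rw [htarget]
  refine hstep.trans ?_
  calc B * Uv / ℓ ^ 2 * (2 * Λ) * ((T / P) ^ (-η) * Real.exp (12 + 6 * L₂ / L₃))
      ≤ X * Real.exp (Real.log (128 * c_B * C_U) + L₃) *
          ((T / P) ^ (-η) * Real.exp (12 + 6 * L₂ / L₃)) :=
        mul_le_mul_of_nonneg_right hF1 (mul_nonneg hTPη0 (Real.exp_pos _).le)
    _ = X * (Real.exp (Real.log (128 * c_B * C_U) + L₃) *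
          ((T / P) ^ (-η) * Real.exp (12 + 6 * L₂ / L₃))) := mul_assoc _ _ _
    _ ≤ X * Real.exp (Real.log (128 * c_B * C_U) + L₃ +
          (w + 1 + 4 * Q - (1 + ε) * L₂ - ε ^ 2 * L₂) + (12 + 6 * L₂ / L₃)) :=
        mul_le_mul_of_nonneg_left (mul_mul_le_exp le_rfl hF2 le_rfl hTPη0 (Real.exp_pos _).le) hX.le
    _ ≤ X * Real.exp (-((1 + ε) * L₂)) :=
        mul_le_mul_of_nonneg_left (Real.exp_le_exp.2 hfin) hX.le

/-- Pure inequality: the sieve bound at scale `N = U/m` in terms of `ℓ = log k₁ ≤ log N`,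
`log z_m ≥ ℓ/16`, `𝔊(m) ≤ G`. [folklore] -/
private theorem term_numeric {S N lN lY Gm G C_FL C_BV ℓ V : ℝ}
    (hS : S ≤ 2 * N / lN * (6 / lY) * Gm * (1 + C_FL) + C_BV * N / lN ^ 8)
    (hℓ1 : 1 ≤ ℓ) (hlN : ℓ ≤ lN) (hlY : ℓ / 16 ≤ lY) (hGm0 : 0 ≤ Gm) (hGm : Gm ≤ G)
    (hCFL : 0 ≤ C_FL) (hCBV : 0 ≤ C_BV) (hN0 : 0 ≤ N) (hNV : N ≤ V) :
    S ≤ (192 * (1 + C_FL) * G + C_BV) * V / ℓ ^ 2 := by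
  have hℓ0 : 0 < ℓ := by linarith
  have hG0 : 0 ≤ G := hGm0.trans hGm
  have h1 : 2 * N / lN ≤ 2 * N / ℓ := div_le_div_of_nonneg_left (by linarith) hℓ0 hlN
  have h2 : 6 / lY ≤ 6 / (ℓ / 16) := div_le_div_of_nonneg_left (by norm_num) (by linarith) hlY
  have h3 : 2 * N / lN * (6 / lY) ≤ 2 * N / ℓ * (6 / (ℓ / 16)) :=
    mul_le_mul h1 h2 (div_nonneg (by norm_num) (by linarith)) (by positivity)
  have h4 : 2 * N / ℓ * (6 / (ℓ / 16)) = 192 * N / ℓ ^ 2 := by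
    field_simp; ring
  have h5 : 2 * N / lN * (6 / lY) * Gm * (1 + C_FL) ≤ 192 * N / ℓ ^ 2 * G * (1 + C_FL) :=
    mul_le_mul_of_nonneg_right (mul_le_mul (h3.trans_eq h4) hGm hGm0 (by positivity))
      (by linarith)
  have h6 : ℓ ^ 2 ≤ lN ^ 8 :=
    (pow_le_pow_right₀ hℓ1 (by norm_num : 2 ≤ 8)).trans (pow_le_pow_left₀ hℓ0.le hlN 8)
  have h7 : C_BV * N / lN ^ 8 ≤ C_BV * N / ℓ ^ 2 :=
    div_le_div_of_nonneg_left (by positivity) (by positivity) h6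
  have h8 : (192 * (1 + C_FL) * G + C_BV) * N / ℓ ^ 2 ≤
      (192 * (1 + C_FL) * G + C_BV) * V / ℓ ^ 2 :=
    div_le_div_of_nonneg_right (mul_le_mul_of_nonneg_left hNV (by positivity)) (by positivity)
  calc S ≤ _ := hS
    _ ≤ 192 * N / ℓ ^ 2 * G * (1 + C_FL) + C_BV * N / ℓ ^ 2 := add_le_add h5 h7
    _ = (192 * (1 + C_FL) * G + C_BV) * N / ℓ ^ 2 := by ring
    _ ≤ _ := h8

/-- The constant `c_B = 192 (1 + C_FL)(3⁹ + 4e⁵)² + C_BV` of the sieve terms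
(`sieve_term_le`), in terms of the fundamental-lemma and Bombieri–Vinogradov constants.
[cite: MaierPomerance1990, proof of Thm 5.3 (implicit constant of its sieve bound)] -/
def cB (C_FL C_BV : ℝ) : ℝ := 192 * (1 + C_FL) * (3 ^ 9 + 4 * Real.exp 5) ^ 2 + C_BV

/-- `c_B > 0`. [folklore] -/
private theorem cB_pos {C_FL C_BV : ℝ} (hCFL : 0 ≤ C_FL) (hCBV : 0 ≤ C_BV) : 0 < cB C_FL C_BV := by
  unfold cB; positivity

/-- **The sieve term at scale `N = U/m`** (`m` even, `k₁ ≤ N`): with `z_m = min(⌊y⌋, ⌊N^{1/8}⌋)`,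
`#{p ≤ N : (mp − 1, P_{z_m}) = 1} ≤ c_B (log₂x)² (U/m)/ℓ²`, `ℓ = log k₁` — the fundamental lemma
+ Bombieri–Vinogradov count `sieve_count_le` with `log N ≥ ℓ`, `log z_m ≥ ℓ/16` and
`𝔊(m) ≤ (m/φ(m))² ≪ (log₂ x)²`. [cite: Maynard2016LargeGaps, §2, Lemma 2;
MaierPomerance1990, Thm 5.3 (proof, the count after (5.3))] -/
theorem sieve_term_le {C_FL K₁ C_BV : ℝ} (hCFL : 0 ≤ C_FL)
    (hFL : ∀ A : SieveSequence, HasSieveDimension A.density 1 K₁ →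
      ∀ x z D : ℝ, 2 ≤ z → z ≤ D → 0 ≤ A.size x →
        |A.sifted x (primesProdBelow z) - A.size x * A.densityProduct (primesProdBelow z)| ≤
          C_FL * A.size x * A.densityProduct (primesProdBelow z) *
              Real.exp (-(Real.log D / Real.log z)) +
            ∑ d ∈ (primesProdBelow z).divisors.filter (fun d : ℕ => (d : ℝ) ≤ D), |A.remainder d x|)
    (hK₁ : HasSieveDimension (shiftedPrimesDensity 2) 1 K₁) (hCBV : 0 ≤ C_BV) {N₀ : ℕ}
    (hBV : ∀ N : ℕ, N₀ ≤ N → ∀ a : (q : ℕ) → (ZMod q)ˣ,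
      ∑ q ∈ Finset.Icc 1 ⌊(N : ℝ) ^ ((1 : ℝ) / 4)⌋₊, |primeCountingDisc q (a q : ZMod q) N| ≤
        C_BV * N / Real.log N ^ 8)
    (hπ : ∀ N : ℕ, N₀ ≤ N → (Nat.primeCounting N : ℝ) ≤ 2 * N / Real.log N)
    {Uf k₁ P m : ℕ} {ℓ Uv L₂ : ℝ} (hk₁ : 3 ≤ k₁) (hN₀k : N₀ ≤ k₁) (hℓ : ℓ = Real.log k₁)
    (hℓ12 : 12 ≤ ℓ) (hk₁big : Real.exp 12 + 1 ≤ (k₁ : ℝ) ^ ((1 : ℝ) / 64))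
    (hm1 : 1 ≤ m) (hmk : m ≤ Uf / k₁) (hm : Even m) (hUf : (Uf : ℝ) ≤ Uv)
    (hP12 : Real.exp 12 ≤ (P : ℝ)) (hlogP : ℓ / 16 ≤ Real.log P)
    (hUf9 : 3 ^ 9 ≤ Uf) (hllU : Real.log (Real.log Uf) ≤ 2 * L₂) (hL₂1 : 1 ≤ L₂) :
    (((((Finset.Ioc 0 (Uf / m)).filter Nat.Prime).filter
        (fun p => Nat.Coprime (m * p - 1)
          (primorial (min P ⌊(((Uf / m : ℕ) : ℝ)) ^ ((1 : ℝ) / 8)⌋₊)))).card : ℕ) : ℝ) ≤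
      cB C_FL C_BV * L₂ ^ 2 * (Uv / m) / ℓ ^ 2 := by
  have hk₁pos : 0 < k₁ := by omega
  have hmpos : 0 < m := hm1
  -- the scale `N = ⌊U⌋/m ≥ k₁`
  have hkN : k₁ ≤ Uf / m := (Nat.le_div_iff_mul_le hmpos).2
    (by have := (Nat.le_div_iff_mul_le hk₁pos).1 hmk; rw [mul_comm]; exact this)
  set N := Uf / m with hNdef
  have hN1 : 1 < N := by omega
  have hN₀N : N₀ ≤ N := hN₀k.trans hkN
  have hNpos : (0 : ℝ) < N := by exact_mod_cast (by omega : 0 < N)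
  have hk₁r : (1 : ℝ) ≤ k₁ := by exact_mod_cast hk₁pos
  have hkNr : (k₁ : ℝ) ≤ N := by exact_mod_cast hkN
  -- `a = N^{1/8} ≥ e^{12} + 1 ≥ 2`
  set a := (N : ℝ) ^ ((1 : ℝ) / 8) with ha
  have ha0 : 0 ≤ a := Real.rpow_nonneg hNpos.le _
  have hage : Real.exp 12 + 1 ≤ a := by
    calc Real.exp 12 + 1 ≤ (k₁ : ℝ) ^ ((1 : ℝ) / 64) := hk₁big
      _ ≤ (k₁ : ℝ) ^ ((1 : ℝ) / 8) := Real.rpow_le_rpow_of_exponent_le hk₁r (by norm_num)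
      _ ≤ a := Real.rpow_le_rpow (Nat.cast_nonneg _) hkNr (by norm_num)
  have he12 : (12 : ℝ) + 1 ≤ Real.exp 12 := Real.add_one_le_exp 12
  have ha2 : 2 ≤ a := by linarith
  have haa : a * a = (N : ℝ) ^ ((1 : ℝ) / 4) := by
    rw [ha, ← Real.rpow_add hNpos]; norm_num
  have hfl : a - 1 < (⌊a⌋₊ : ℝ) := by have := Nat.lt_floor_add_one a; linarith
  -- facts about `z_m = min P ⌊a⌋₊`
  set Ys := min P ⌊a⌋₊ with hYs
  have hYs12 : Real.exp 12 ≤ (Ys : ℝ) := by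
    rw [hYs, Nat.cast_min]
    exact le_min hP12 (by linarith)
  have hYsD : ((Ys + 1 : ℕ) : ℝ) ≤ (N : ℝ) ^ ((1 : ℝ) / 4) := by
    have h1 : (Ys : ℝ) ≤ ⌊a⌋₊ := by exact_mod_cast min_le_right _ _
    have h2 : (⌊a⌋₊ : ℝ) ≤ a := Nat.floor_le ha0
    push_cast
    rw [← haa]; nlinarith
  have hlogYs : ℓ / 16 ≤ Real.log Ys := by
    rcases min_choice P ⌊a⌋₊ with h | h <;> rw [hYs, h]
    · exact hlogP
    · have h3 : a / 2 ≤ (⌊a⌋₊ : ℝ) := by linarith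
      have h4 : Real.log (a / 2) ≤ Real.log (⌊a⌋₊ : ℝ) := Real.log_le_log (by linarith) h3
      have h5 : Real.log (a / 2) = (1 : ℝ) / 8 * Real.log N - Real.log 2 := by
        rw [Real.log_div (by linarith) (by norm_num), ha, Real.log_rpow hNpos]
      have h6 : ℓ ≤ Real.log N := by rw [hℓ]; exact Real.log_le_log (by positivity) hkNr
      have h7 : Real.log 2 < 0.6931471808 := Real.log_two_lt_d9
      linarith
  -- the sieve count
  have hS := sieve_count_le hCFL hFL hK₁ (hBV N hN₀N) (hπ N hN₀N) hN1 hm1 hm hYs12 hYsD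
  -- `𝔊(m) ≤ (m/φ(m))² ≤ (3⁹ + 4e⁵ L₂)² ≤ (3⁹ + 4e⁵)² L₂²`
  have hmUf : m ≤ Uf := hmk.trans (Nat.div_le_self _ _)
  have hφ := self_div_totient_le hm1 hmUf hUf9
  have hG1 : oddSingProd m ≤ (3 ^ 9 + 4 * Real.exp 5 * L₂) ^ 2 := by
    refine (oddSingProd_le_sq_div_totient hm1).trans (pow_le_pow_left₀ (by positivity) ?_ 2)
    have : 2 * Real.exp 5 * Real.log (Real.log Uf) ≤ 2 * Real.exp 5 * (2 * L₂) :=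
      mul_le_mul_of_nonneg_left hllU (by positivity)
    linarith
  have hG2 : (3 ^ 9 + 4 * Real.exp 5 * L₂) ^ 2 ≤ ((3 ^ 9 + 4 * Real.exp 5) * L₂) ^ 2 := by
    refine pow_le_pow_left₀ (by positivity) ?_ 2
    nlinarith [Real.exp_pos 5]
  -- conclude
  have hlN : ℓ ≤ Real.log N := by rw [hℓ]; exact Real.log_le_log (by positivity) hkNr
  have hNV : (N : ℝ) ≤ Uv / m := by
    rw [hNdef]
    exact Nat.cast_div_le.trans (div_le_div_of_nonneg_right hUf (Nat.cast_nonneg _))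
  have hT := term_numeric hS (by linarith) hlN hlogYs (oddSingProd_nonneg m) (hG1.trans hG2) hCFL
    hCBV hNpos.le hNV
  refine hT.trans ?_
  have hcoef : 192 * (1 + C_FL) * ((3 ^ 9 + 4 * Real.exp 5) * L₂) ^ 2 + C_BV ≤
      cB C_FL C_BV * L₂ ^ 2 := by
    rw [cB]
    have hL₂sq : 1 ≤ L₂ ^ 2 := one_le_pow₀ hL₂1
    have h1 := mul_le_mul_of_nonneg_left hL₂sq hCBV
    have h2 : (192 * (1 + C_FL) * (3 ^ 9 + 4 * Real.exp 5) ^ 2 + C_BV) * L₂ ^ 2 =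
        192 * (1 + C_FL) * ((3 ^ 9 + 4 * Real.exp 5) * L₂) ^ 2 + C_BV * L₂ ^ 2 := by ring
    rw [h2]; linarith
  have hV0 : 0 ≤ Uv / m := div_nonneg ((Nat.cast_nonneg Uf).trans hUf) (Nat.cast_nonneg m)
  exact div_le_div_of_nonneg_right (mul_le_mul_of_nonneg_right hcoef hV0) (sq_nonneg ℓ)

/-! ### Assembly: Lemma 2 -/

/-- `Λ = (1 − ε) L L₃/L₂`: `108 L₂ ≤ Λ ≤ L/2` and `18 L/L₂ ≤ Λ`. [folklore] -/
private theorem Lambda_facts {ε L L₂ L₃ Λ : ℝ} (hε0 : 0 < ε) (hε : ε ≤ 1 / 4)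
    (hΛ : Λ = (1 - ε) * (L * L₃ / L₂)) (hL₂ge : 100 ≤ L₂) (hL₃ge : 24 ≤ L₃)
    (hL₃L₂ : 2 * L₃ ≤ L₂) (hLL₂ : 6 * L₂ ^ 2 ≤ L) :
    108 * L₂ ≤ Λ ∧ Λ ≤ L / 2 ∧ 18 * L / L₂ ≤ Λ := by
  have hL₂0 : 0 < L₂ := by linarith
  have hL₃0 : 0 < L₃ := by linarith
  have hL0 : 0 < L := by nlinarith
  have h1 : (3 : ℝ) / 4 ≤ 1 - ε := by linarith
  have hA0 : 0 ≤ L * L₃ / L₂ := by positivity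
  have hA : 144 * L₂ ≤ L * L₃ / L₂ := by
    rw [le_div_iff₀ hL₂0]
    have := mul_le_mul hLL₂ hL₃ge (by norm_num) hL0.le
    nlinarith
  refine ⟨?_, ?_, ?_⟩
  · have h2 : (3 : ℝ) / 4 * (144 * L₂) ≤ (1 - ε) * (L * L₃ / L₂) :=
      mul_le_mul h1 hA (by positivity) (by linarith)
    rw [hΛ]; linarith
  · have h2 : L * L₃ / L₂ ≤ L / 2 := by
      rw [div_le_iff₀ hL₂0]; nlinarith [mul_le_mul_of_nonneg_left hL₃L₂ hL0.le]
    have h3 : (1 - ε) * (L * L₃ / L₂) ≤ L * L₃ / L₂ := by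
      have : 0 ≤ ε * (L * L₃ / L₂) := mul_nonneg hε0.le hA0
      nlinarith
    rw [hΛ]; linarith
  · have h2 : 24 * L / L₂ ≤ L * L₃ / L₂ := by
      refine div_le_div_of_nonneg_right ?_ hL₂0.le
      nlinarith [mul_le_mul_of_nonneg_left hL₃ge hL0.le]
    have h3 : (3 : ℝ) / 4 * (24 * L / L₂) ≤ (1 - ε) * (L * L₃ / L₂) :=
      mul_le_mul h1 h2 (by positivity) (by linarith)
    rw [hΛ]
    have : 18 * L / L₂ = 3 / 4 * (24 * L / L₂) := by ring
    linarith

/-- The pure growth facts in `X` used by Lemma 2 (`L₂ = log₂ X`, `L₃ = log₃ X`, `L₄ = log₄ X`):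
`L₂ ≥ 100, b`; `L₃ ≥ 24, 24/ε²`; `L₄ ≥ 1`; `16 L₄ ≤ ε² L₃`; `8 L₃ ≤ ε² L₂`; `a ≤ ε² L₂`;
`6 L₂² ≤ log X`, `L₂² ≤ 18 C_U log X`; `C_U log X ≤ X`. [folklore] -/
private theorem eventually_logs₂ {ε C_U : ℝ} (hε : 0 < ε) (hCU : 0 < C_U) (a b : ℝ) :
    ∀ᶠ X : ℝ in atTop,
      100 ≤ Real.log (Real.log X) ∧ 24 ≤ Real.log (Real.log (Real.log X)) ∧
      1 ≤ Real.log (Real.log (Real.log (Real.log X))) ∧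
      16 * Real.log (Real.log (Real.log (Real.log X))) ≤
        ε ^ 2 * Real.log (Real.log (Real.log X)) ∧
      24 ≤ ε ^ 2 * Real.log (Real.log (Real.log X)) ∧
      8 * Real.log (Real.log (Real.log X)) ≤ ε ^ 2 * Real.log (Real.log X) ∧
      a ≤ ε ^ 2 * Real.log (Real.log X) ∧
      6 * Real.log (Real.log X) ^ 2 ≤ Real.log X ∧
      Real.log (Real.log X) ^ 2 ≤ 18 * C_U * Real.log X ∧
      b ≤ Real.log (Real.log X) ∧
      C_U * Real.log X ≤ X := by
  have hT₁ : Tendsto (fun X : ℝ => Real.log X) atTop atTop := Real.tendsto_log_atTop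
  have hT₂ : Tendsto (fun X : ℝ => Real.log (Real.log X)) atTop atTop :=
    Real.tendsto_log_atTop.comp hT₁
  have hT₃ : Tendsto (fun X : ℝ => Real.log (Real.log (Real.log X))) atTop atTop :=
    Real.tendsto_log_atTop.comp hT₂
  have hT₄ : Tendsto (fun X : ℝ => Real.log (Real.log (Real.log (Real.log X)))) atTop atTop :=
    Real.tendsto_log_atTop.comp hT₃
  have hε2 : 0 < ε ^ 2 := by positivity
  have h4' := hT₃.eventually
    (Real.isLittleO_log_id_atTop.bound (show (0 : ℝ) < ε ^ 2 / 16 by positivity))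
  have h6' := hT₂.eventually
    (Real.isLittleO_log_id_atTop.bound (show (0 : ℝ) < ε ^ 2 / 8 by positivity))
  have hδ : (0 : ℝ) < min (1 / 6) (18 * C_U) := lt_min (by norm_num) (by positivity)
  have h8' := hT₁.eventually ((Real.isLittleO_pow_log_id_atTop (n := 2)).bound hδ)
  have h11' := Real.isLittleO_log_id_atTop.bound (show (0 : ℝ) < 1 / C_U by positivity)
  filter_upwards [hT₁.eventually_ge_atTop 1, hT₂.eventually_ge_atTop 100,
    hT₃.eventually_ge_atTop 24, hT₄.eventually_ge_atTop 1, hT₃.eventually_ge_atTop (24 / ε ^ 2),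
    hT₂.eventually_ge_atTop (a / ε ^ 2), hT₂.eventually_ge_atTop b, h4', h6', h8', h11',
    eventually_ge_atTop (0 : ℝ)] with X hL1 hL₂ hL₃ hL₄ h5 h7 hb h4 h6 h8 h11 hX0
  have hL0 : 0 < Real.log X := by linarith
  have hL₂0 : 0 < Real.log (Real.log X) := by linarith
  have hL₃0 : 0 < Real.log (Real.log (Real.log X)) := by linarith
  have hL₄0 : 0 < Real.log (Real.log (Real.log (Real.log X))) := by linarith
  rw [Real.norm_eq_abs, Real.norm_eq_abs, id, abs_of_nonneg hL₄0.le, abs_of_nonneg hL₃0.le] at h4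
  rw [Real.norm_eq_abs, Real.norm_eq_abs, id, abs_of_nonneg hL₃0.le, abs_of_nonneg hL₂0.le] at h6
  rw [Real.norm_eq_abs, Real.norm_eq_abs, id, abs_of_nonneg (sq_nonneg _),
    abs_of_nonneg hL0.le] at h8
  rw [Real.norm_eq_abs, Real.norm_eq_abs, id, abs_of_nonneg hL0.le, abs_of_nonneg hX0] at h11
  have h8a : min (1 / 6) (18 * C_U) * Real.log X ≤ 1 / 6 * Real.log X :=
    mul_le_mul_of_nonneg_right (min_le_left _ _) hL0.le
  have h8b : min (1 / 6) (18 * C_U) * Real.log X ≤ 18 * C_U * Real.log X :=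
    mul_le_mul_of_nonneg_right (min_le_right _ _) hL0.le
  refine ⟨hL₂, hL₃, hL₄, by linarith, ?_, by linarith, ?_, by linarith, by linarith, hb, ?_⟩
  · have := (div_le_iff₀ hε2).1 h5; linarith
  · have := (div_le_iff₀ hε2).1 h7; linarith
  · have h := mul_le_mul_of_nonneg_left h11 hCU.le
    have : C_U * (1 / C_U * X) = X := by field_simp
    linarith

set_option maxHeartbeats 400000 in
/-- **Lemma 2 at one `x`**, given the sieve inputs (fundamental lemma `hFL` with the dimension-1
constant `K₁`, Bombieri–Vinogradov `hBV` and Chebyshev `hπ` beyond `N₀`) and the growth facts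
G1–G12 in `L = log x`, `L₂, L₃, L₄`: `#𝓡' ≤ 3x/(log x)^{1+ε}` — one `x/(log x)^{1+ε}` each for the
small integers, the `y^{1/8}`-smooth ones (`smooth_part_le`) and the sifted ones (`sifted_part_le`).
[cite: Maynard2016LargeGaps, Lemma 2; MaierPomerance1990, Thm 5.3] -/
theorem lemma2_core {C_FL K₁ C_BV : ℝ} (hCFL : 0 ≤ C_FL)
    (hFL : ∀ A : SieveSequence, HasSieveDimension A.density 1 K₁ →
      ∀ x z D : ℝ, 2 ≤ z → z ≤ D → 0 ≤ A.size x →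
        |A.sifted x (primesProdBelow z) - A.size x * A.densityProduct (primesProdBelow z)| ≤
          C_FL * A.size x * A.densityProduct (primesProdBelow z) *
              Real.exp (-(Real.log D / Real.log z)) +
            ∑ d ∈ (primesProdBelow z).divisors.filter (fun d : ℕ => (d : ℝ) ≤ D), |A.remainder d x|)
    (hK₁ : HasSieveDimension (shiftedPrimesDensity 2) 1 K₁) (hCBV : 0 ≤ C_BV) {N₀ : ℕ}
    (hBV : ∀ N : ℕ, N₀ ≤ N → ∀ a : (q : ℕ) → (ZMod q)ˣ,
      ∑ q ∈ Finset.Icc 1 ⌊(N : ℝ) ^ ((1 : ℝ) / 4)⌋₊, |primeCountingDisc q (a q : ZMod q) N| ≤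
        C_BV * N / Real.log N ^ 8)
    (hπ : ∀ N : ℕ, N₀ ≤ N → (Nat.primeCounting N : ℝ) ≤ 2 * N / Real.log N)
    {ε C_U : ℝ} (hε0 : 0 < ε) (hε : ε ≤ 1 / 4) (hCU : 0 < C_U) {x : ℕ} {X L L₂ L₃ L₄ : ℝ}
    (hX : X = (x : ℝ)) (hLX : L = Real.log X) (hL₂ : L₂ = Real.log L) (hL₃ : L₃ = Real.log L₂)
    (hL₄ : L₄ = Real.log L₃)
    (h1 : 100 ≤ L₂) (h2 : 24 ≤ L₃) (h3 : 1 ≤ L₄) (h4 : 16 * L₄ ≤ ε ^ 2 * L₃)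
    (h5 : 24 ≤ ε ^ 2 * L₃) (h6 : 8 * L₃ ≤ ε ^ 2 * L₂)
    (h7 : 4 * (Real.log (128 * cB C_FL C_BV * C_U) + 13) ≤ ε ^ 2 * L₂)
    (h8 : 6 * L₂ ^ 2 ≤ L) (h9 : L₂ ^ 2 ≤ 18 * C_U * L) (h10 : 8 * (Real.log C_U + 12) ≤ L₂)
    (h11 : (N₀ : ℝ) ≤ L₂) (h12 : C_U * L ≤ X) :
    ((Rprime C_U ε x).card : ℝ) ≤ 3 * X / L ^ (1 + ε) := by
  -- basic positivity
  have hL₂0 : 0 < L₂ := by linarith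
  have hL₂1 : 1 ≤ L₂ := by linarith
  have hL0 : 0 < L := by nlinarith
  have hX0 : 0 < X := lt_of_lt_of_le (mul_pos hCU hL0) h12
  have hε21 : ε ^ 2 ≤ 1 := by nlinarith
  have hL₃0 : 0 < L₃ := by linarith
  have hL₄le : 16 * L₄ ≤ L₃ := h4.trans (by nlinarith)
  have hL₃L₂ : 2 * L₃ ≤ L₂ := by nlinarith
  have hLexp : Real.exp L = X := by rw [hLX, Real.exp_log hX0]
  have h600 : 600 * L₂ ≤ L := by nlinarith [mul_nonneg hL₂0.le (sub_nonneg.2 h1)]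
  have hεL₂ : ε * L₂ ≤ 1 / 4 * L₂ := mul_le_mul_of_nonneg_right hε hL₂0.le
  have hlog2 : Real.log 2 < 0.6931471808 := Real.log_two_lt_d9
  have hlog2pos : 0 < Real.log 2 := Real.log_pos (by norm_num)
  -- `Λ = log y`
  obtain ⟨Λ, hΛ⟩ : ∃ Λ : ℝ, Λ = (1 - ε) * (L * L₃ / L₂) := ⟨_, rfl⟩
  obtain ⟨hΛlo, hΛhalf, hΛ18⟩ := Lambda_facts hε0 hε hΛ h1 h2 hL₃L₂ h8
  have hΛ0 : 0 < Λ := by linarith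
  have hy0 : 0 < y ε x := Real.exp_pos _
  have hlogy : Real.log (y ε x) = Λ := by rw [log_y, hΛ, hL₃, hL₂, hLX, hX]
  have hyexp : y ε x = Real.exp Λ := by rw [← hlogy, Real.exp_log hy0]
  -- `T = x/(log x)^{1+ε}`
  obtain ⟨T, hTdef⟩ : ∃ T : ℝ, T = X / L ^ (1 + ε) := ⟨_, rfl⟩
  have hT0 : 0 < T := by rw [hTdef]; exact div_pos hX0 (Real.rpow_pos_of_pos hL0 _)
  have hTlog : Real.log T = L - (1 + ε) * L₂ := by
    rw [hTdef, Real.log_div hX0.ne' (Real.rpow_pos_of_pos hL0 _).ne', Real.log_rpow hL0, ← hLX,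
      ← hL₂]
  have hΛT : Λ ≤ Real.log T := by rw [hTlog]; linarith
  -- `P = ⌊y⌋`
  obtain ⟨P, hPdef⟩ : ∃ P : ℕ, P = ⌊y ε x⌋₊ := ⟨_, rfl⟩
  have hy13 : Real.exp 13 ≤ y ε x := by rw [hyexp]; exact Real.exp_le_exp.2 (by linarith)
  have he12 : (13 : ℝ) ≤ Real.exp 12 := by have := Real.add_one_le_exp (12 : ℝ); linarith
  have he13 : 2 * Real.exp 12 ≤ Real.exp 13 := by
    have h2e : (2 : ℝ) ≤ Real.exp 1 := by have := Real.add_one_le_exp (1 : ℝ); linarith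
    have := mul_le_mul_of_nonneg_left h2e (Real.exp_pos 12).le
    rw [← Real.exp_add, show (12 : ℝ) + 1 = 13 by norm_num] at this
    linarith
  have hPfl : y ε x - 1 < (P : ℝ) := by have := Nat.lt_floor_add_one (y ε x); rw [hPdef]; linarith
  have hPle : (P : ℝ) ≤ y ε x := by rw [hPdef]; exact Nat.floor_le hy0.le
  have hP12 : Real.exp 12 ≤ (P : ℝ) := by linarith
  have hP2r : (2 : ℝ) ≤ P := by linarith
  have hP2 : 2 ≤ P := by exact_mod_cast hP2r
  have hP0 : (0 : ℝ) < P := by linarith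
  have hPΛ : Real.log P ≤ Λ := by rw [← hlogy]; exact Real.log_le_log hP0 hPle
  have hP1Λ : Real.log ((P : ℝ) + 1) ≤ Λ + 1 := by
    have h1' : (P : ℝ) + 1 ≤ 2 * y ε x := by linarith
    calc Real.log ((P : ℝ) + 1) ≤ Real.log (2 * y ε x) := Real.log_le_log (by linarith) h1'
      _ = Real.log 2 + Λ := by rw [Real.log_mul (by norm_num) hy0.ne', hlogy]
      _ ≤ Λ + 1 := by linarith
  have hlogPlo : Λ - Real.log 2 ≤ Real.log P := by
    have h1' : y ε x / 2 ≤ P := by linarith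
    calc Λ - Real.log 2 = Real.log (y ε x / 2) := by
          rw [Real.log_div hy0.ne' (by norm_num), hlogy]
      _ ≤ Real.log P := Real.log_le_log (by linarith) h1'
  have hTP : 1 ≤ T / P := by
    rw [one_le_div hP0]
    calc (P : ℝ) ≤ y ε x := hPle
      _ = Real.exp Λ := hyexp
      _ ≤ Real.exp (Real.log T) := Real.exp_le_exp.2 hΛT
      _ = T := Real.exp_log hT0
  -- `k₁ = ⌊y^{1/8}⌋ + 1`, `ℓ = log k₁`
  obtain ⟨r, hr⟩ : ∃ r : ℝ, r = y ε x ^ ((1 : ℝ) / 8) := ⟨_, rfl⟩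
  have hrexp : r = Real.exp (Λ / 8) := by
    rw [hr, Real.rpow_def_of_pos hy0, hlogy]; congr 1; ring
  have hr0 : 0 < r := by rw [hrexp]; exact Real.exp_pos _
  have hrge : Λ / 8 + 1 ≤ r := by rw [hrexp]; exact Real.add_one_le_exp _
  obtain ⟨k₁, hk₁def⟩ : ∃ k : ℕ, k = ⌊r⌋₊ + 1 := ⟨_, rfl⟩
  have hk₁r : r < k₁ := by rw [hk₁def]; push_cast; exact Nat.lt_floor_add_one r
  have hk₁le : (k₁ : ℝ) ≤ r + 1 := by
    rw [hk₁def]; push_cast; linarith [Nat.floor_le hr0.le]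
  have hk₁0 : (0 : ℝ) < k₁ := hr0.trans hk₁r
  have hk₁3 : 3 ≤ k₁ := by
    have : (3 : ℝ) ≤ k₁ := by linarith
    exact_mod_cast this
  have hk₁2 : 2 ≤ k₁ := by omega
  obtain ⟨ℓ, hℓ⟩ : ∃ ℓ : ℝ, ℓ = Real.log k₁ := ⟨_, rfl⟩
  have hlogr : Real.log r = Λ / 8 := by rw [hrexp, Real.log_exp]
  have hℓlo : Λ / 8 ≤ ℓ := by rw [hℓ, ← hlogr]; exact Real.log_le_log hr0 hk₁r.le
  have hℓhi : ℓ ≤ Λ / 8 + Real.log 2 := by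
    have h1' : (k₁ : ℝ) ≤ 2 * r := by linarith
    calc ℓ ≤ Real.log (2 * r) := by rw [hℓ]; exact Real.log_le_log hk₁0 h1'
      _ = Real.log 2 + Λ / 8 := by rw [Real.log_mul (by norm_num) hr0.ne', hlogr]
      _ = Λ / 8 + Real.log 2 := add_comm _ _
  have hℓ12 : 12 ≤ ℓ := by linarith
  have hN₀k : N₀ ≤ k₁ := by
    have : (N₀ : ℝ) ≤ k₁ := by linarith
    exact_mod_cast this
  have hk₁big : Real.exp 12 + 1 ≤ (k₁ : ℝ) ^ ((1 : ℝ) / 64) := by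
    rw [Real.rpow_def_of_pos hk₁0, ← hℓ]
    have h1' : (13 : ℝ) ≤ ℓ * ((1 : ℝ) / 64) := by linarith
    calc Real.exp 12 + 1 ≤ Real.exp 13 := by linarith
      _ ≤ _ := Real.exp_le_exp.2 h1'
  have hlogP16 : ℓ / 16 ≤ Real.log P := by linarith
  -- `U`, `⌊U⌋`
  obtain ⟨Uv, hUvdef⟩ : ∃ Uv : ℝ, Uv = U C_U ε x := ⟨_, rfl⟩
  have hUv : Uv = C_U * (X * Λ / L₂) := by rw [hUvdef, U, hlogy, hL₂, hLX, hX]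
  have hCUΛ : L₂ ≤ C_U * Λ := by
    have h1' : C_U * (18 * L / L₂) ≤ C_U * Λ := mul_le_mul_of_nonneg_left hΛ18 hCU.le
    have h2' : L₂ ≤ C_U * (18 * L / L₂) := by
      rw [show C_U * (18 * L / L₂) = 18 * C_U * L / L₂ by ring, le_div_iff₀ hL₂0, ← pow_two]
      exact h9
    linarith
  have hXU : X ≤ Uv := by
    rw [hUv, show C_U * (X * Λ / L₂) = X * (C_U * Λ / L₂) by ring]
    have : 1 ≤ C_U * Λ / L₂ := by rw [le_div_iff₀ hL₂0, one_mul]; exact hCUΛ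
    exact le_mul_of_one_le_right hX0.le this
  have hUv0 : 0 < Uv := hX0.trans_le hXU
  obtain ⟨Uf, hUfdef⟩ : ∃ Uf : ℕ, Uf = ⌊Uv⌋₊ := ⟨_, rfl⟩
  have hUfle : (Uf : ℝ) ≤ Uv := by rw [hUfdef]; exact Nat.floor_le hUv0.le
  have hxUf : x ≤ Uf := by
    rw [hUfdef]; refine Nat.le_floor ?_; rw [← hX]; exact hXU
  have hUf9 : 3 ^ 9 ≤ Uf := by
    have h1' : ((3 ^ 9 : ℕ) : ℝ) ≤ x := by
      rw [← hX, ← hLexp]; push_cast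
      have := Real.add_one_le_exp L; linarith
    exact (by exact_mod_cast h1' : 3 ^ 9 ≤ x).trans hxUf
  have hUfpos : (0 : ℝ) < Uf := by exact_mod_cast (lt_of_lt_of_le (by norm_num) hUf9 : 0 < Uf)
  have hllU : Real.log (Real.log Uf) ≤ 2 * L₂ := by
    have hΛL : Λ ≤ L := by linarith
    have h1' : Uv ≤ X * X := by
      rw [hUv, show C_U * (X * Λ / L₂) = X * (C_U * Λ / L₂) by ring]
      refine mul_le_mul_of_nonneg_left ?_ hX0.le
      calc C_U * Λ / L₂ ≤ C_U * Λ := div_le_self (mul_nonneg hCU.le hΛ0.le) hL₂1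
        _ ≤ C_U * L := mul_le_mul_of_nonneg_left hΛL hCU.le
        _ ≤ X := h12
    have h2' : Real.log Uf ≤ 2 * L := by
      have := Real.log_le_log hUfpos (hUfle.trans h1')
      rw [Real.log_mul hX0.ne' hX0.ne', ← hLX] at this; linarith
    have h3' : 0 < Real.log Uf := Real.log_pos (by
      have : ((3 ^ 9 : ℕ) : ℝ) ≤ Uf := by exact_mod_cast hUf9
      push_cast at this; linarith)
    calc Real.log (Real.log Uf) ≤ Real.log (2 * L) := Real.log_le_log h3' h2'
      _ = Real.log 2 + L₂ := by rw [Real.log_mul (by norm_num) hL0.ne', hL₂]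
      _ ≤ 2 * L₂ := by linarith
  -- the decomposition
  set Ys : ℕ → ℕ := fun m => min P ⌊(((Uf / m : ℕ) : ℝ)) ^ ((1 : ℝ) / 8)⌋₊ with hYs
  have hRp : Rprime C_U ε x = (Finset.Icc 1 Uf).filter
      (fun n => (∀ p ∈ n.primeFactors, p ≤ P) ∧ Nat.Coprime (n - 1) (primorial P)) := by
    rw [hUfdef, hUvdef, hPdef]; rfl
  have hdec := card_smooth_coprime_le_decomp Uf P hP2 hT0.le hk₁3 Ys (fun m => min_le_left _ _)
  rw [hRp]
  -- S₁
  have hS₁ := smooth_part_le hL₂ hL₃ hL₄ hε0 hε hCU hX0 hΛ hUv hUfle hXU hk₁2 hℓ hℓlo hℓhi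
    (w := L₃ - 2 * L₄) rfl hLX h1 h2 h3 hL₄le hL₃L₂ h8 h10
  -- S₂
  set M := ((((Finset.Icc 1 (Uf / k₁)).filter (· ∈ Nat.smoothNumbers (P + 1))).filter
      (fun m : ℕ => T / P ≤ (m : ℝ))).filter (fun m => Even m)) with hM
  have hF : ∀ m ∈ M, (((((Finset.Ioc 0 (Uf / m)).filter Nat.Prime).filter
      (fun p => Nat.Coprime (m * p - 1) (primorial (Ys m)))).card : ℕ) : ℝ) ≤
        cB C_FL C_BV * L₂ ^ 2 * (Uv / m) / ℓ ^ 2 := by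
    intro m hm
    simp only [hM, Finset.mem_filter, Finset.mem_Icc] at hm
    obtain ⟨⟨⟨⟨hm1, hmk⟩, -⟩, -⟩, heven⟩ := hm
    exact sieve_term_le hCFL hFL hK₁ hCBV hBV hπ hk₁3 hN₀k hℓ hℓ12 hk₁big hm1 hmk heven hUfle
      hP12 hlogP16 hUf9 hllU hL₂1
  have hS₂ := sifted_part_le M _ hF (Finset.filter_subset _ _) hL₂ hL₃ hL₄ hε0 hε hCU hX0 hΛ hUv
    hP2 hPΛ hP1Λ hT0 hTlog hTP hℓlo (w := L₃ - 2 * L₄) rfl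
    (mul_nonneg (cB_pos hCFL hCBV).le (sq_nonneg _)) le_rfl
    (cB_pos hCFL hCBV) h1 h2 h3 hL₃L₂ h8 h4 h5 h6 h7
  -- total
  have htot := hdec.trans (add_le_add (add_le_add le_rfl hS₁) hS₂)
  calc _ ≤ _ := htot
    _ = 3 * X / L ^ (1 + ε) := by rw [hTdef]; ring

/-- **Maynard 2016, Lemma 2** (= Maier–Pomerance [MP90, Thm 5.3]), PROVED:
`#𝓡' ≤ 3x/(log x)^{1+ε}` for every `C_U > 0`, `0 < ε ≤ 1/4` and `x ≥ x₀(ε, C_U)`.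
Inputs, all proved in the tree: the uniform fundamental lemma at dimension 1
(`SieveSequence.fundamental_lemma_uniform_holds`), the dimension of `g₂`
(`SieveSequence.hasSieveDimension_shiftedPrimes_one_holds`), Bombieri–Vinogradov in `π`-form
(`Chen.eventually_sum_abs_primeCountingDisc_le BombieriVinogradovStatement_holds`), Chebyshev's
bound (`Chen.eventually_primeCounting_bounds`), Rankin's bounds for smooth numbers
(`card_smoothNumbersUpTo_le_rankin`, `SmoothRankin.sum_inv_smooth_tail_le`).
[cite: Maynard2016LargeGaps, Lemma 2; MaierPomerance1990, Thm 5.3] -/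
theorem lemma2_holds : Lemma2 := by
  intro C_U hCU
  -- the fundamental lemma, uniformly at dimension `1` with the constant of `g_2`
  obtain ⟨K₁, hK₁⟩ := hasSieveDimension_shiftedPrimes_one_holds (h := 2) even_two
  rw [SieveSequence.shiftedPrimes_density] at hK₁
  obtain ⟨C_FL, hCFL, hFL⟩ := SieveSequence.fundamental_lemma_uniform_holds 1 K₁
  -- Bombieri–Vinogradov in `π`-form at level `N^{1/4}`, saving `(log N)^8`; Chebyshev
  obtain ⟨C₀, hC₀⟩ := Chen.eventually_sum_abs_primeCountingDisc_le
    BombieriVinogradovStatement_holds (θ₁ := 1 / 4) (by norm_num) (A := 8) (by norm_num)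
  obtain ⟨N₀, hN₀⟩ := Filter.eventually_atTop.1
    (hC₀.and (Chen.eventually_primeCounting_bounds one_pos))
  have hCBV : (0 : ℝ) ≤ max C₀ 1 := le_trans zero_le_one (le_max_right _ _)
  have hBV : ∀ N : ℕ, N₀ ≤ N → ∀ a : (q : ℕ) → (ZMod q)ˣ,
      ∑ q ∈ Finset.Icc 1 ⌊(N : ℝ) ^ ((1 : ℝ) / 4)⌋₊, |primeCountingDisc q (a q : ZMod q) N| ≤
        max C₀ 1 * N / Real.log N ^ 8 := by
    intro N hN a
    refine ((hN₀ N hN).1 a).trans ?_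
    rw [show (8 : ℝ) = ((8 : ℕ) : ℝ) by norm_num, Real.rpow_natCast, mul_div_assoc, mul_div_assoc]
    exact mul_le_mul_of_nonneg_right (le_max_left _ _)
      (div_nonneg (Nat.cast_nonneg _) (pow_nonneg (Real.log_natCast_nonneg N) _))
  have hπ : ∀ N : ℕ, N₀ ≤ N → (Nat.primeCounting N : ℝ) ≤ 2 * N / Real.log N := by
    intro N hN
    have := (hN₀ N hN).2.2
    rw [mul_div_assoc]; linarith
  -- `0 < ε ≤ 1/4`
  have hε : ∀ᶠ ε : ℝ in 𝓝[>] 0, 0 < ε ∧ ε ≤ 1 / 4 := by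
    filter_upwards [eventually_nhdsWithin_of_forall (s := Set.Ioi (0 : ℝ)) (fun ε hε => hε),
      (eventually_le_nhds (show (0 : ℝ) < 1 / 4 by norm_num)).filter_mono nhdsWithin_le_nhds]
      with ε h1 h2
    exact ⟨h1, h2⟩
  filter_upwards [hε] with ε hε
  refine ⟨3, by norm_num, ?_⟩
  filter_upwards [tendsto_natCast_atTop_atTop.eventually (eventually_logs₂ hε.1 hCU
    (4 * (Real.log (128 * cB C_FL (max C₀ 1) * C_U) + 13))
    (max (8 * (Real.log C_U + 12)) N₀))] with x hg
  obtain ⟨h1, h2, h3, h4, h5, h6, h7, h8, h9, hb, h12⟩ := hg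
  exact lemma2_core hCFL.le hFL hK₁ hCBV hBV hπ hε.1 hε.2 hCU rfl rfl rfl rfl rfl h1 h2 h3 h4 h5
    h6 h7 h8 h9 ((le_max_left _ _).trans hb) ((le_max_right _ _).trans hb) h12

end Maynard2016

end Literature.NumberTheory.Sieve
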